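import Literature.AlgebraicGeometry.Resolution.PointBlowupMohWitnessPrimePower
import HarnessLib

/-!
# The residue inequality of the lost exceptional components: Hauser–Perlega's conditions (4) and
  (6) for an increase of the shade at order `pᵉ`, in every dimension

Topic: `Literature/AlgebraicGeometry/Resolution`. Reproduction (cell `pub-hironaka`, unit
`b2b-hironaka-cp4`, DIM-4 CENSUS gen 16; sequel of `PointBlowupMohBoundPrimePower.lean`,
`PointBlowupNoConsecutiveJumps.lean` and `PointBlowupMohWitnessPrimePower.lean`, which prove
assertions (2), (7) and (9) of the same theorem in the same model) of

* H. Hauser, S. Perlega, *Characterizing the increase of the residual order under blowup in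
  positive characteristic*, Publ. RIMS **55** (2019) 835–857 = arXiv:1906.09593
  [HauserPerlega2019PRIMS], §3 **Theorem**, assertions **(4)** and **(6)** and **Comment (d)**, for
  ideals of order `c = q = pᵉ` generated by a purely inseparable equation (`m = 1`, `c!` replaced
  by `1` on the shade scale) and POINT blow-ups (`S = {1, …, n}`). Verbatim (p. 7 of the arXiv
  text): "(4) Factorize `F` into `F(x) = x^r · G(x)` with `r_i = ord_{(x_i)} F`, for `i ∈ T`, and `G`
  a homogeneous polynomial of degree `u = deg F − Σ_{i∈T} r_i`. If `Q_T` denotes the ideal of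
  `K[[x₁,…,x_n]]` generated by `x_i − t_i x₁`, for `i ∈ T∖{1}`, and `x_i`, for `i ∉ T`, then
  `ord^{mod pᵉ}_{Q_T} F > u`, where `ord^{mod pᵉ}_Q F` denotes the maximum of the orders
  `ord_Q(F + H^{pᵉ})` over all polynomials `H`"; "Let `ℓ < e` be the largest integer so that `F`
  is a `p^ℓ`-th power, and denote by `b` the number of exponents `r_i`, for `i ∈ T`, not congruent
  to `0` modulo `p^{ℓ+1}`. … (6) The residues `0 ≤ r̄_i < p^{ℓ+1}` of `r_i` modulo `p^{ℓ+1}`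
  satisfy the arithmetic inequality `Σ_{i∈T} r̄_i ≤ (b − 1)·p^{ℓ+1}`"; Comment "(d) The increase
  of the residual order can only happen if under the blowup at least two components of `D` are
  lost when passing to the reference point `a′` in the new exceptional component"; and the PROOF of
  (5)–(6) in §5 (last two pages): "`G((1,x₂,…,x_n)+t) = ⌊∏_{i∈T∖{1}}(x_i+t_i)^{−r_i}·N^{pᵉ}⌋_u`
  … Now assume that they are violated … `∏(x_i+t_i)^{−r_i} = ∏(x_i+t_i)^{\overline{−r_i}}·
  L^{p^{ℓ+1}}` … `deg ∏(x_i+t_i)^{\overline{−r_i}} ≤ Σ_{i∈T}\overline{−r_i} = b·p^{ℓ+1} −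
  Σ_{i∈T} r̄_i = ū` … Consequently `∏(x_i+t_i)^{r_i}·G((1,x₂,…,x_n)+t)` is a `p^{ℓ+1}`-th power.
  Since the degree of `F` is divisible by `p^{ℓ+1}`, also `F = x^r·G` is a `p^{ℓ+1}`-th power,
  which contradicts the minimality of `p^ℓ` and proves (6)."
* H. Hauser, S. Perlega, *Resolving surface singularities in positive characteristic*, Publ. RIMS
  **60** (2024) 767–813 [HauserPerlega2024], §4, p. 777: "It turns out that the increase
  `d′_res > d_res` can only happen if `E_a` has two components and both are lost under the
  localized point blowup. Due to a result by Moh [Moh87], the increase is bounded by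
  `d′_res ≤ d_res + p^{e−1}`."

## What is proved (every field `K` of characteristic `p`, every finite index type `σ` of residual
## variables — hypersurfaces `x^{pᵉ} + F(y) = 0` of EVERY dimension — every `e ≥ 1`, every point
## `b` of every chart `y_j` of the blow-up of the origin; the model `PointBlowupShade.lean`)

Write `T = lostComponents j b = {j} ∪ {i : b_i ≠ 0}` (the index set `T ∋ 1` of the source:
the chart's component and the translated ones), `In F` for the initial form of `F` (its homogeneous
component of degree `o = ord₀ F`), and `Φ_{j,b}(P) = P(y_j ↦ 1, y_i ↦ y_i + b_i)` for the
dehomogenisation of a homogeneous `P` at the point (so that `ord_{Q_T}` of a homogeneous `P`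
is the order of `Φ_{j,b}(P)` at the origin, and the source's "`ord^{mod q}`" is the order up to
monomials with all exponents divisible by `q`).

* `PointBlowup.coeff_pointTransform_of_apply_eq` — the LOWEST `y_j`-LAYER of the translated chart
  transform `translate b (chartTransform q j F)` is `y_j^{o−q} · Φ_{j,b}(In F)`: the blow-up is
  monomial in Hauser–Perlega's parameters `y_i = x_i − t_i x₁` (§2).
* `PointBlowup.degree_newMult_add_sum_lost` — the threshold: `|r′| + Σ_{i∈T} r_i = (o − q) + |r|`.
* `PointBlowup.isPthPowerExponent_of_shadeIncreases`, **`PointBlowup.dvd_of_shadeIncreases_of_mem_support_dehomog`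
  — assertion (4) in the model**: if the shade increases at `(j, b)`, every monomial of the
  translated chart transform of degree `≤ |r′| + shade` is a `q`-th-power exponent (it is deleted
  by the cleaning), hence every monomial of `Φ_{j,b}(In F)` of degree `≤ o − Σ_{i∈T} r_i` has all
  exponents divisible by `q` — `ord^{mod q}_{Q_T} In F > u`, with the state's `r_i` (which are at
  most the printed `ord_{(x_i)} In F`, so this is the printed (4) and slightly more). Valid for every
  natural `q`, no cleanness needed.
* **`PointBlowup.forall_dvd_of_not_residueInequality` — the algebra "(4) ⟹ (6)"** for an arbitrary
  homogeneous `P` of degree `o`, `p^{ℓ+1} ∣ o`: if (4) holds at level `p^{ℓ+1}` below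
  `u = o − Σ_{i∈T} ρ_i` and the residue inequality fails for `ρ`, then `P ∈ K[y₁^{p^{ℓ+1}}, …]`.
* **`PointBlowup.residueInequality_of_shadeIncreases_of_le` / `…_of_shadeIncreases` /
  `…_of_shadeIncreases_of_clean` — assertion (6)**: the tree's predicate
  `HauserPerlega2019.ResidueInequality p k (lostComponents j b) ρ` of `PointBlowupShade.lean`
  ("Condition (6) … [never asserted]") HOLDS whenever the shade increases at `(j, b)`, for the
  printed multiplicities `ρ_i ∈ [r_i, ord_{y_i} In F]`, for the state's `r`, and — for a cleaned
  state — at the top level `p^{k+1} = q`; at EVERY level `k < e` at which `In F` has an exponent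
  not divisible by `p^{k+1}` (the source states `k = ℓ`, the least such level; its proof covers all).
* `PointBlowup.two_le_card_of_residueInequality`, `PointBlowup.exists_pair_of_residueInequality` —
  the inequality forces `b ≥ 2`.
* **`PointBlowup.exists_two_lost_of_shadeIncreases` — Comment (d) / [HP24] p. 777**: an increase at
  `(j, b)` from a cleaned state needs two distinct indices `i₁, i₂ ∈ T` (lost components) with
  `q ∤ r_{i₁}`, `q ∤ r_{i₂}`; `PointBlowup.not_shadeIncreases_of_card_le_one`: a state with at
  most one multiplicity `r_i ≢ 0 (mod q)` admits no increase at any point of any chart.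

* §5, consequences DERIVED in the model (not printed in this form; the ingredient is Comment (d)):
  `PointBlowup.filter_not_dvd_step_r_eq` / `card_filter_not_dvd_step_r_le` (one blow-up creates at
  most one multiplicity `≢ 0 (mod q)` — the new component's, iff `q ∤ o − q` — and keeps only the
  kept ones), **`PointBlowup.card_filter_not_dvd_step_r_add_two_le_of_shadeIncreases`** (an increase
  consumes two such multiplicities and creates none), **`PointBlowup.two_mul_card_increases_add_card_le`**
  (coin counting along any sequence of point blow-ups on the equimultiple branch:
  `2·#{increases among the first N steps} + c_N ≤ c_0 + #{non-increasing steps at orders ≢ 0 mod q}`,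
  `c_n` the number of multiplicities `≢ 0 (mod q)` at stage `n`),
  `PointBlowup.not_shadeIncreases_two_steps_of_card_eq_zero` and
  **`PointBlowup.not_shadeIncreases_two_steps_after_increase_of_card_eq_two`** (two residual
  variables — surfaces: after an increase, neither of the next two blow-ups increases the shade,
  every `e`).

## Method (the printed proof, with the coefficient ideal replaced by a polynomial identity)

(4): the new residual polynomial is the cleaning of `translate b (chartTransform q j F)`; an
increase means that it has no monomial of degree `≤ θ = |r′| + shade`, so every such monomial of
the uncleaned transform is a `q`-th-power exponent; the monomials `y^E` with `E_j = o − q` are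
`y_j^{o−q}` times those of `Φ_{j,b}(In F)`, and `θ − (o − q) = o − Σ_{i∈T} r_i`. (6), by
contradiction, as printed: with `ρ` supported on `T`, `P := In F = y^ρ·G`, `a_i := (−ρ_i) mod
p^{ℓ+1}`, `U := Φ(y^ρ) = ∏_{i∈T∖j}(y_i+b_i)^{ρ_i}`, `A := Φ(y^a)`: `W := U·A = Φ(y^{ρ+a})` is the
`p^{ℓ+1}`-th power of a polynomial (Frobenius on supports, `forall_support_pow_char_pow`), with
non-zero constant term `w₀ = ∏ b_i^{ρ_i+a_i}`; the truncated geometric series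
`V = w₀⁻¹ Σ_{t ≤ u} Y^t`, `Y = 1 − w₀⁻¹W`, has `W·V = 1 − Y^{u+1}` (`mul_neg_geom_sum`) with
`Y^{u+1}` of order `> u`; from `A·Φ(P) = W·Φ(G)` one gets `Φ(G) = ⌊A·V·N⌋_u` (`N` the part of
`Φ(P)` of degree `≤ u`, an exponent-`p^{ℓ+1}` polynomial by (4)) — the source's (5) — and, the
violated inequality giving `deg A ≤ Σ_{i∈T} a_i = u mod p^{ℓ+1}` (`sum_compl_mod_eq_of_not_residueInequality`),
`⌊A·V·N⌋_u = A·⌊V·N⌋_{u − ū}` (`lowPart_mul_of_forall_dvd`: the degrees of the monomials of the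
exponent-`p^{ℓ+1}` polynomial `V·N` are multiples of `p^{ℓ+1}`); so `Φ(P) = W·⌊V·N⌋_{u−ū}` has all
exponents divisible by `p^{ℓ+1}`, and so has `P` (translate back by `−b` —
`forall_support_dvd_translate`, Frobenius — and read `P` off `P(y_j ↦ 1)`,
`coeff_erase_flat_of_isHomogeneous`, the degree `o` being divisible by `p^{ℓ+1}`): contradiction
with the level hypothesis. No power series, no coefficient ideals; `q ∣ o` (assertion (2)) enters
through `shade_step_le_of_not_dvd` of `PointBlowupMohBound.lean`.

## What is NOT proved here (scope, honest)

* Ground field. The source's theorem is stated over an ALGEBRAICALLY CLOSED field `K` (§2: "over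
  an algebraically closed field `K`"; §3 Theorem: "Let `R` be a complete regular local noetherian
  ring `R` of dimension `n+1` over an algebraically closed field `K` of positive characteristic
  `p > 0`"), where
  "`F` is a `p^ℓ`-th power" is equivalent to "every exponent of `F` is divisible by `p^ℓ`". The
  statements below are made for every field `K` of characteristic `p`, with the level hypothesis in
  the EXPONENT reading (`hlevel : ∃ d ∈ F.support, d.degree = o ∧ ∃ i, ¬ p ^ (k + 1) ∣ d i`, "the
  initial form has an exponent not divisible by `p^{k+1}`") — the model's notion throughout (the
  cleaning `deletePthPowers` of `PointBlowupShade.lean` is exponent-based), and the printed notion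
  over a perfect `K`; over an imperfect `K` it is stronger than "`In F` is not the `p^{k+1}`-th power
  of a polynomial" (coefficients need not be `p`-th powers), so there the theorems speak of the
  model's exponent condition only, as does the whole model.
* Assertions (3) (the tangent cone is the `m`-th power of a purely inseparable form — automatic for
  `m = 1`), (5) as a separate statement (it is the intermediate identity `Φ(G) = ⌊A·V·N⌋_u` of the
  proof), (8), and Comment (g) (the converse: (5) ∧ (6) ⇒ increase for weighted homogeneous
  singularities); ideals of order `m·pᵉ` with `m > 1`; centres of positive dimension (the source
  allows any permissible `S ⊇ T`; here `S` = all variables, as in the other files of the model).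
* Fixed coordinates: the source normalises `T ∖ {1}` to EXCEPTIONAL translated variables by the
  coordinate change `x_i ↦ x_i + t_i x₁` for non-exceptional ones (§2, "We may further assume that
  either `T = {1}` or that for all indices `i ∈ T` the inclusion `V(x_i) ⊂ D` holds"); the model has
  no coordinate changes, so `T = lostComponents j b` may contain translated non-exceptional
  indices (`r_i = 0`) and a non-exceptional chart index — these have residue `0` and do not count
  in `b`, and occur in `In F` with `q`-divisible exponents only
  (`pow_dvd_apply_of_shadeIncreases_of_nonexceptional`, `PointBlowupMohWitnessPrimePower.lean`), so
  the inequality proved is the printed one.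
* §5 is bookkeeping over `newMult` plus Comment (d); it bounds the FREQUENCY of increases (at most
  one per two steps taken at orders `≢ 0 (mod q)`, plus half the initial stock) but says nothing
  about their size beyond `PointBlowupMohBoundPrimePower.lean`, and nothing about the long-run
  behaviour for `e ≥ 2` (divergent for `e ≥ 3`, `n ≥ 4`: `ResidualOrderUnbounded*.lean`; open in
  print for `e = 2`).
* Nothing here is a statement about resolution of singularities; census value only (row O5 of the
  dimension-4 census of `pub-hironaka`: the arithmetic of the LOST COMPONENTS at a jump of the
  classical residual order at multiplicity `pᵉ`, kernel-checked in every dimension; an increase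
  consumes two exceptional components with non-`q`-divisible multiplicities, while the component
  it creates has multiplicity `o − q ≡ 0 (mod q)`).

AI-assisted formalisation (pub-hironaka cell); the informal gloss above is the cell's reading of
the cited pages, the Lean statements are what is certified.
-/

noncomputable section

open MvPolynomial Finset

open scoped BigOperators

namespace Literature.AlgebraicGeometry.Resolution

open Literature.AlgebraicGeometry.Resolution.Hauser2010
open Literature.Barriers.ResolutionOfSingularities

namespace PointBlowup

/-! ## 1. Exponent-`P₁` polynomials, low parts, degrees (support bookkeeping) -/

section Bookkeeping

variable {σ : Type*} {K : Type*} [Field K] [Fintype σ] [DecidableEq σ]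

omit [Fintype σ] [DecidableEq σ] in
/-- The coefficients of the low part `∑_{n ≤ N} P_n` of a polynomial. [folklore] -/
theorem coeff_lowPart (N : ℕ) (f : MvPolynomial σ K) (m : σ →₀ ℕ) :
    coeff m (∑ n ∈ Finset.range (N + 1), homogeneousComponent n f) =
      if m.degree ≤ N then coeff m f else 0 := by
  rw [coeff_sum]
  simp_rw [coeff_homogeneousComponent]
  rw [Finset.sum_ite_eq]
  simp only [Finset.mem_range, Nat.lt_succ_iff]

omit [Fintype σ] [DecidableEq σ] in
/-- The low part of a polynomial all of whose monomials have degree `≤ N` is the polynomial. [folklore] -/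
theorem lowPart_eq_self_of_forall_le (N : ℕ) (f : MvPolynomial σ K)
    (hf : ∀ m ∈ f.support, m.degree ≤ N) :
    ∑ n ∈ Finset.range (N + 1), homogeneousComponent n f = f := by
  ext m
  rw [coeff_lowPart]
  split_ifs with h
  · rfl
  · by_contra hne
    exact h (hf m (MvPolynomial.mem_support_iff.mpr (Ne.symm hne)))

omit [Fintype σ] [DecidableEq σ] in
/-- The low part of a polynomial all of whose monomials have degree `> N` vanishes. [folklore] -/
theorem lowPart_eq_zero_of_forall_lt (N : ℕ) (f : MvPolynomial σ K)
    (hf : ∀ m ∈ f.support, N < m.degree) :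
    ∑ n ∈ Finset.range (N + 1), homogeneousComponent n f = 0 := by
  ext m
  rw [coeff_lowPart, coeff_zero]
  split_ifs with h
  · by_contra hne
    exact absurd (hf m (MvPolynomial.mem_support_iff.mpr hne)) (not_lt.mpr h)
  · rfl

omit [Fintype σ] [DecidableEq σ] in
/-- The monomials of the low part. [folklore] -/
theorem mem_support_lowPart {N : ℕ} {f : MvPolynomial σ K} {m : σ →₀ ℕ}
    (hm : m ∈ (∑ n ∈ Finset.range (N + 1), homogeneousComponent n f).support) :
    m ∈ f.support ∧ m.degree ≤ N := by
  rw [MvPolynomial.mem_support_iff, coeff_lowPart] at hm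
  split_ifs at hm with h
  · exact ⟨MvPolynomial.mem_support_iff.mpr hm, h⟩
  · exact absurd rfl hm

omit [Fintype σ] [DecidableEq σ] in
/-- The monomials of the high part `f − ∑_{n ≤ N} f_n`. [folklore] -/
theorem lt_degree_of_mem_support_sub_lowPart {N : ℕ} {f : MvPolynomial σ K} {m : σ →₀ ℕ}
    (hm : m ∈ (f - ∑ n ∈ Finset.range (N + 1), homogeneousComponent n f).support) :
    N < m.degree := by
  rw [MvPolynomial.mem_support_iff, coeff_sub, coeff_lowPart] at hm
  by_contra h
  rw [if_pos (not_lt.mp h), sub_self] at hm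
  exact hm rfl

omit [DecidableEq σ] in
/-- A sum of `P₁`-divisible exponents has `P₁`-divisible degree. [folklore] -/
theorem dvd_degree_of_forall_dvd {P₁ : ℕ} {m : σ →₀ ℕ} (h : ∀ i, P₁ ∣ m i) : P₁ ∣ m.degree := by
  rw [Finsupp.degree_eq_sum]
  exact Finset.dvd_sum fun i _ => h i

omit [Fintype σ] [DecidableEq σ] in
/-- The monomials of `X i + C c` have degree `≤ 1`. [folklore] -/
theorem forall_support_X_add_C (i : σ) (c : K) :
    ∀ m ∈ (X i + C c : MvPolynomial σ K).support, m.degree ≤ 1 := by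
  classical
  refine forall_support_add (forall_support_X ?_) (forall_support_C ?_ c)
  · rw [Finsupp.degree_single]
  · rw [map_zero]; exact Nat.zero_le _

omit [Fintype σ] [DecidableEq σ] in
/-- The monomials of a polynomial with zero constant coefficient have positive degree. [folklore] -/
theorem one_le_degree_of_constantCoeff_eq_zero {f : MvPolynomial σ K} (hf : constantCoeff f = 0) :
    ∀ m ∈ f.support, 1 ≤ m.degree := by
  intro m hm
  by_contra h
  have hm0 : m = 0 := (Finsupp.degree_eq_zero_iff m).mp (by omega)
  subst hm0
  exact (MvPolynomial.mem_support_iff.mp hm) (by rwa [← constantCoeff_eq] )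

end Bookkeeping

/-! ## 2. The dehomogenisation at the point and the lowest `y_j`-layer of the transform -/

section Dehomogenization

variable {σ : Type*} {K : Type*} [Field K] [Fintype σ] [DecidableEq σ]

/-- The dehomogenisation `Φ_{j,b}` (`y_j ↦ 1`, `y_i ↦ y_i + b_i`) on a monomial:
`Φ(c·y^d) = c · ∏_{i ≠ j} (y_i + b_i)^{d_i}`. [folklore] -/
theorem dehomog_monomial (j : σ) (b : σ → K) (d : σ →₀ ℕ) (c : K) :
    aeval (fun i => if i = j then (1 : MvPolynomial σ K) else X i + C (b i)) (monomial d c) =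
      C c * ∏ i ∈ univ.erase j, (X i + C (b i)) ^ (d i) := by
  rw [aeval_monomial, algebraMap_eq, Finsupp.prod_pow,
    ← Finset.mul_prod_erase univ
      (fun i => (if i = j then (1 : MvPolynomial σ K) else X i + C (b i)) ^ d i) (mem_univ j)]
  rw [if_pos rfl, one_pow, one_mul]
  congr 1
  refine Finset.prod_congr rfl fun i hi => ?_
  rw [if_neg (Finset.ne_of_mem_erase hi)]

/-- The monomials of `Φ_{j,b}(P)` do not involve `y_j`. [folklore] -/
theorem apply_eq_zero_of_mem_support_dehomog (j : σ) (b : σ → K) (P : MvPolynomial σ K) :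
    ∀ m ∈ (aeval (fun i => if i = j then (1 : MvPolynomial σ K) else X i + C (b i)) P).support,
      m j = 0 := by
  conv => enter [m, 1]; rw [P.as_sum, map_sum]
  refine forall_support_sum _ _ fun d _ => ?_
  rw [dehomog_monomial]
  have hC : ∀ m ∈ (C (coeff d P) : MvPolynomial σ K).support, m j = 0 :=
    forall_support_C (P := fun m => m j = 0) (Finsupp.zero_apply) _
  have hfac : ∀ i ∈ univ.erase j, ∀ m ∈ ((X i + C (b i)) ^ (d i) : MvPolynomial σ K).support,
      m j = 0 := by
    intro i hi
    have hX : ∀ m ∈ (X i + C (b i) : MvPolynomial σ K).support, m j = 0 := by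
      refine forall_support_add (forall_support_X (P := fun m => m j = 0) ?_)
        (forall_support_C (P := fun m => m j = 0) (Finsupp.zero_apply) _)
      rw [Finsupp.single_apply, if_neg (Finset.ne_of_mem_erase hi)]
    have := forall_support_pow (P := fun _ m => m j = 0) (n := 0) (Finsupp.zero_apply)
      (fun _ _ a c ha hc => by rw [Finsupp.add_apply, ha, hc, add_zero]) hX (d i)
    exact this
  have hprod := forall_support_prod (P := fun _ m => m j = 0) (Finsupp.zero_apply)
    (fun _ _ a c ha hc => by rw [Finsupp.add_apply, ha, hc, add_zero]) (univ.erase j)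
    (fun i => (X i + C (b i)) ^ (d i)) (fun _ => 0) hfac
  exact forall_support_mul (P := fun m => m j = 0) (Q := fun m => m j = 0) (S := fun m => m j = 0)
    (fun a c ha hc => by rw [Finsupp.add_apply, ha, hc, add_zero]) hC hprod

/-- `Φ_{j,b}` does not raise degrees: if every monomial of `P` has degree `≤ D`, so has every
monomial of `Φ_{j,b}(P)`. [folklore] -/
theorem degree_le_of_mem_support_dehomog (j : σ) (b : σ → K) (P : MvPolynomial σ K) (D : ℕ)
    (hP : ∀ d ∈ P.support, d.degree ≤ D) :
    ∀ m ∈ (aeval (fun i => if i = j then (1 : MvPolynomial σ K) else X i + C (b i)) P).support,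
      m.degree ≤ D := by
  conv => enter [m, 1]; rw [P.as_sum, map_sum]
  refine forall_support_sum _ _ fun d hd => ?_
  rw [dehomog_monomial]
  have h1 : ∀ m ∈ (∏ i ∈ univ.erase j, (X i + C (b i)) ^ (d i) : MvPolynomial σ K).support,
      m.degree ≤ ∑ i ∈ univ.erase j, d i := by
    refine forall_support_prod (P := fun n m => m.degree ≤ n) (by rw [map_zero])
      (fun _ _ a c ha hc => by rw [map_add]; omega) _ _ (fun i => d i) fun i _ => ?_
    have := forall_support_pow (P := fun n m => m.degree ≤ n) (by rw [map_zero])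
      (fun _ _ a c ha hc => by rw [map_add]; omega) (forall_support_X_add_C i (b i)) (d i)
    rwa [mul_one] at this
  have h2 : ∑ i ∈ univ.erase j, d i ≤ D := by
    have := degree_eq_add_sum_erase j d
    have := hP d hd
    omega
  have hC : ∀ m ∈ (C (coeff d P) : MvPolynomial σ K).support, m.degree ≤ 0 :=
    forall_support_C (P := fun m => m.degree ≤ 0) (by rw [map_zero]) _
  exact forall_support_mul (P := fun m => m.degree ≤ 0)
    (Q := fun m => m.degree ≤ ∑ i ∈ univ.erase j, d i) (S := fun m => m.degree ≤ D)
    (fun a c ha hc => by rw [map_add]; omega) hC h1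

omit [Fintype σ] in
/-- `E − (o − q)·e_j = E` with the `j`-th entry erased, when `E_j = o − q`. [folklore] -/
theorem sub_single_eq_erase {E : σ →₀ ℕ} {j : σ} {n : ℕ} (hEj : E j = n) :
    E - Finsupp.single j n = E.erase j := by
  ext i
  rw [Finsupp.tsub_apply, Finsupp.single_apply, Finsupp.erase_apply]
  by_cases h : i = j
  · subst h; rw [if_pos rfl, if_pos rfl, hEj, Nat.sub_self]
  · rw [if_neg (Ne.symm h), if_neg h, Nat.sub_zero]

omit [Fintype σ] in
/-- `m + (n)·e_j` with the `j`-th entry erased is `m`, when `m_j = 0`. [folklore] -/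
theorem erase_add_single_of_apply_eq_zero {m : σ →₀ ℕ} {j : σ} (hmj : m j = 0) (n : ℕ) :
    (m + Finsupp.single j n).erase j = m := by
  ext i
  rw [Finsupp.erase_apply, Finsupp.add_apply, Finsupp.single_apply]
  by_cases h : i = j
  · subst h; rw [if_pos rfl, hmj]
  · rw [if_neg h, if_neg (Ne.symm h), add_zero]

/-- **The lowest `y_j`-layer of the translated chart transform is `y_j^{o−q} · Φ_{j,b}(In F)`.**
For a residual polynomial `F` of order `o ≥ q` and a point `b` of the `y_j`-chart (`b_j = 0`), the
coefficient of a monomial `y^E` with `E_j = o − q` in `translate b (chartTransform q j F)` is the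
coefficient of `y^{E − (o−q)e_j}` in the dehomogenisation `Φ_{j,b}(In F) = (In F)(y_j ↦ 1,
y_i ↦ y_i + b_i)` of the initial form `In F` of `F` (the monomials of `F` of degree `> o` land
in higher layers `E_j > o − q`). [cite: HauserPerlega2019PRIMS, §4 (proof of the Proposition: the blowup is monomial in the parameters y_i = x_i − t_i x₁)] -/
theorem coeff_pointTransform_of_apply_eq (q : ℕ) (j : σ) (b : σ → K) (hbj : b j = 0)
    (s : State σ K) {o : ℕ} (ho : ordZero s.F = o) (hqo : q ≤ o) {E : σ →₀ ℕ}
    (hEj : E j = o - q) :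
    coeff E (pointTransform q j b s) =
      coeff (E.erase j) (aeval (fun i => if i = j then (1 : MvPolynomial σ K) else X i + C (b i))
        (homogeneousComponent o s.F)) := by
  classical
  have hdeg := le_degree_of_ordZero_eq s ho
  rw [pointTransform_eq_sum, coeff_sum, homogeneousComponent_apply, map_sum, coeff_sum,
    Finset.sum_filter]
  refine Finset.sum_congr rfl fun d hd => ?_
  by_cases hdo : d.degree = o
  · rw [if_pos hdo, translate_monomial_eq_prod, dehomog_monomial,
      ← Finset.mul_prod_erase univ _ (mem_univ j)]
    have hcj : chartExponent q j d j = o - q := by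
      rw [chartExponent_apply, if_pos rfl, hdo]
    have hprod : ∏ i ∈ univ.erase j, (X i + C (b i)) ^ (chartExponent q j d i) =
        ∏ i ∈ univ.erase j, ((X i + C (b i)) ^ (d i) : MvPolynomial σ K) := by
      refine Finset.prod_congr rfl fun i hi => ?_
      rw [chartExponent_apply, if_neg (Finset.ne_of_mem_erase hi)]
    rw [hprod, hcj, hbj, C_0, add_zero, X_pow_eq_monomial, mul_left_comm, coeff_monomial_mul',
      if_pos (by rw [Finsupp.single_le_iff, hEj]), one_mul, sub_single_eq_erase hEj]
  · rw [if_neg hdo]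
    by_contra hne
    have h1 := apply_eq_of_coeff_translate_monomial_ne_zero b hbj hne
    rw [chartExponent_apply, if_pos rfl, hEj] at h1
    have h2 := hdeg d hd
    omega

variable [DecidableEq K]

/-- **The threshold.** `|r′| + Σ_{i ∈ T} r_i = (o − q) + |r|` for the lost components
`T = {j} ∪ {i : b_i ≠ 0}` of the point `b` of the `y_j`-chart (`r′ = newMult`): the threshold
`θ = |r′| + shade` which the new order must exceed for the shade to increase is
`(o − q) + (o − Σ_{i ∈ T} r_i)`. [folklore] -/
theorem degree_newMult_add_sum_lost (q : ℕ) (j : σ) (b : σ → K) (hbj : b j = 0) (s : State σ K)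
    {o : ℕ} (ho : ordZero s.F = o) :
    (newMult q j b s).degree + ∑ i ∈ lostComponents j b, s.r i = (o - q) + s.r.degree := by
  rw [newMult_eq q j b hbj s ho, Finsupp.degree_eq_sum, Finsupp.degree_eq_sum, lostComponents,
    Finset.sum_filter, ← Finset.sum_add_distrib]
  have hterm : ∀ i, (Finsupp.filter (fun i => b i = 0) (s.r.update j (o - q))) i +
      (if i = j ∨ b i ≠ 0 then s.r i else 0) = (if i = j then o - q else 0) + s.r i := by
    intro i
    rw [Finsupp.filter_apply, Finsupp.update_apply]
    by_cases hij : i = j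
    · subst hij
      rw [if_pos hbj, if_pos rfl, if_pos (Or.inl rfl), if_pos rfl]
    · rw [if_neg hij, if_neg hij, zero_add]
      by_cases hbi : b i = 0
      · rw [if_pos hbi, if_neg (by tauto), add_zero]
      · rw [if_neg hbi, if_pos (Or.inr hbi), zero_add]
  simp_rw [hterm]
  rw [Finset.sum_add_distrib, Finset.sum_ite_eq' univ j, if_pos (mem_univ j)]

omit [Fintype σ] in
/-- **[HP19 PRIMS] assertion (4), model form, layer version: below the threshold the transform is
a `q`-th power.** If the shade increases at the point `b` of the `y_j`-chart, every monomial
`y^E` of the translated chart transform `translate b (chartTransform q j F)` of degree at most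
the threshold `|r′| + shade` is a `q`-th-power exponent (it is deleted by the cleaning — the new
residual polynomial has no monomial of degree `≤ |r′| + shade`). Valid for every natural number
`q` (no primality) and without any cleanness hypothesis on `F`.
[cite: HauserPerlega2019PRIMS, §3 Theorem (4)] -/
theorem isPthPowerExponent_of_shadeIncreases (q : ℕ) (j : σ) (b : σ → K) (s : State σ K)
    {o : ℕ} (ho : ordZero s.F = o) (hinc : ShadeIncreases q j b s) {E : σ →₀ ℕ}
    (hE : E ∈ (pointTransform q j b s).support)
    (hdeg : E.degree ≤ (newMult q j b s).degree + (o - s.r.degree)) :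
    IsPthPowerExponent q E := by
  by_contra hnp
  have hE' : E ∈ (step q j b s).F.support := by
    rw [MvPolynomial.mem_support_iff]
    show coeff E (deletePthPowers q (pointTransform q j b s)) ≠ 0
    rw [coeff_deletePthPowers, if_neg hnp]
    exact MvPolynomial.mem_support_iff.mp hE
  have h1 := shade_le_of_mem_support (step q j b s) hE' (m := o - s.r.degree) hdeg
  rw [← shade_eq_of_ordZero_eq s ho] at h1
  exact absurd hinc (not_lt.mpr h1)

/-- **[HP19 PRIMS] assertion (4), model form: `ord^{mod q}_{Q_T} In F > u`.** If the shade
increases at the point `b` of the `y_j`-chart (order `o ≥ q`, `y^r ∣ F`), then every monomial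
`y^m` of the dehomogenised initial form `Φ_{j,b}(In F) = (In F)(y_j ↦ 1, y_i ↦ y_i + b_i)` of
degree `|m| ≤ o − Σ_{i ∈ T} r_i` (`T = {j} ∪ {i : b_i ≠ 0}` the lost components) has all its
exponents divisible by `q`: in Hauser–Perlega's words, the order of `In F` along the line `Q_T`
modulo `q`-th powers exceeds `u = deg In F − Σ_{i ∈ T} r_i` (their (4), with the multiplicities
`r_i` of the state, which are at most the orders `ord_{y_i} In F` of the printed statement — the
printed form follows, `residueInequality_of_shadeIncreases_geometric`). Every natural `q`.
[cite: HauserPerlega2019PRIMS, §3 Theorem (4)] -/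
theorem dvd_of_shadeIncreases_of_mem_support_dehomog (q : ℕ) (j : σ) (b : σ → K) (hbj : b j = 0)
    (s : State σ K) {o : ℕ} (ho : ordZero s.F = o) (hqo : q ≤ o)
    (hr : ∀ d ∈ s.F.support, s.r ≤ d) (hinc : ShadeIncreases q j b s) {m : σ →₀ ℕ}
    (hm : m ∈ (aeval (fun i => if i = j then (1 : MvPolynomial σ K) else X i + C (b i))
      (homogeneousComponent o s.F)).support)
    (hdeg : m.degree + ∑ i ∈ lostComponents j b, s.r i ≤ o) : ∀ i, q ∣ m i := by
  have hmj := apply_eq_zero_of_mem_support_dehomog j b _ m hm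
  set E : σ →₀ ℕ := m + Finsupp.single j (o - q) with hEdef
  have hEj : E j = o - q := by
    rw [hEdef, Finsupp.add_apply, hmj, Finsupp.single_eq_same, zero_add]
  have hEm : E.erase j = m := erase_add_single_of_apply_eq_zero hmj _
  have hE : E ∈ (pointTransform q j b s).support := by
    rw [MvPolynomial.mem_support_iff, coeff_pointTransform_of_apply_eq q j b hbj s ho hqo hEj, hEm]
    exact MvPolynomial.mem_support_iff.mp hm
  -- `|r| ≤ o` and the threshold arithmetic
  obtain ⟨⟨d₀, hd₀, hd₀deg⟩, -⟩ := (ordZero_eq_nat_iff _ _).mp ho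
  have hro : s.r.degree ≤ o :=
    hd₀deg ▸ degree_le_degree_of_le (hr d₀ (MvPolynomial.mem_support_iff.mpr hd₀))
  have hsum : ∑ i ∈ lostComponents j b, s.r i ≤ s.r.degree := by
    rw [Finsupp.degree_eq_sum]
    exact Finset.sum_le_sum_of_subset_of_nonneg (Finset.subset_univ _) fun _ _ _ => Nat.zero_le _
  have hthr := degree_newMult_add_sum_lost q j b hbj s ho
  have hEdeg : E.degree ≤ (newMult q j b s).degree + (o - s.r.degree) := by
    rw [hEdef, map_add, Finsupp.degree_single]
    omega
  have hP := isPthPowerExponent_of_shadeIncreases q j b s ho hinc hE hEdeg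
  rw [isPthPowerExponent_iff] at hP
  intro i
  by_cases hij : i = j
  · rw [hij, hmj]; exact dvd_zero _
  · have := hP i
    rwa [hEdef, Finsupp.add_apply, Finsupp.single_apply, if_neg (Ne.symm hij), add_zero] at this

end Dehomogenization

/-! ## 3. The algebra of [HP19 PRIMS] (4) ⟹ (6): a violated residue inequality forces the initial
form to be a `p^{ℓ+1}`-th power -/

section Algebra

variable {σ : Type*} {K : Type*} [Field K] [Fintype σ] [DecidableEq σ]

/-! ### Exponent-`P₁` polynomials (`f ∈ K[y₁^{P₁}, …, y_n^{P₁}]`, read on exponents) -/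

omit [Fintype σ] in
/-- Exponent predicates propagate through differences. [folklore] -/
theorem forall_support_sub {P : (σ →₀ ℕ) → Prop} {f g : MvPolynomial σ K}
    (hf : ∀ m ∈ f.support, P m) (hg : ∀ m ∈ g.support, P m) :
    ∀ m ∈ (f - g).support, P m := by
  rw [sub_eq_add_neg]
  refine forall_support_add hf fun m hm => hg m ?_
  rwa [MvPolynomial.support_neg] at hm

omit [Fintype σ] in
/-- Products of exponent-`P₁` polynomials are exponent-`P₁`. [folklore] -/
theorem forall_support_dvd_mul {P₁ : ℕ} {f g : MvPolynomial σ K}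
    (hf : ∀ m ∈ f.support, ∀ i, P₁ ∣ m i) (hg : ∀ m ∈ g.support, ∀ i, P₁ ∣ m i) :
    ∀ m ∈ (f * g).support, ∀ i, P₁ ∣ m i :=
  forall_support_mul (P := fun m => ∀ i, P₁ ∣ m i) (Q := fun m => ∀ i, P₁ ∣ m i)
    (S := fun m => ∀ i, P₁ ∣ m i)
    (fun a c ha hc i => by rw [Finsupp.add_apply]; exact dvd_add (ha i) (hc i)) hf hg

omit [Fintype σ] in
/-- Powers of exponent-`P₁` polynomials are exponent-`P₁`. [folklore] -/
theorem forall_support_dvd_pow {P₁ : ℕ} {f : MvPolynomial σ K}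
    (hf : ∀ m ∈ f.support, ∀ i, P₁ ∣ m i) (k : ℕ) :
    ∀ m ∈ (f ^ k).support, ∀ i, P₁ ∣ m i := by
  have := forall_support_pow (P := fun _ m => ∀ i, P₁ ∣ m i) (n := 0)
    (fun i => by rw [Finsupp.zero_apply]; exact dvd_zero _)
    (fun _ _ a c ha hc i => by rw [Finsupp.add_apply]; exact dvd_add (ha i) (hc i)) hf k
  exact this

omit [Fintype σ] [DecidableEq σ] in
/-- Constants are exponent-`P₁`. [folklore] -/
theorem forall_support_dvd_C {P₁ : ℕ} (c : K) :
    ∀ m ∈ (C c : MvPolynomial σ K).support, ∀ i, P₁ ∣ m i :=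
  forall_support_C (P := fun m => ∀ i, P₁ ∣ m i)
    (fun i => by rw [Finsupp.zero_apply]; exact dvd_zero _) c

/-- **Translations preserve exponent-`p^c` polynomials** (Frobenius: `(y_i + b_i)^{p^c k} =
(y_i^{p^c} + b_i^{p^c})^k` in characteristic `p`). [folklore] -/
theorem forall_support_dvd_translate (p : ℕ) [hp : Fact p.Prime] [CharP K p] (c : ℕ)
    (b : σ → K) {f : MvPolynomial σ K} (hf : ∀ m ∈ f.support, ∀ i, p ^ c ∣ m i) :
    ∀ m ∈ (translate b f).support, ∀ i, p ^ c ∣ m i := by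
  rw [translate_eq_sum_support]
  refine forall_support_sum _ _ fun d hd => ?_
  rw [translate_monomial_eq_prod]
  refine forall_support_dvd_mul (forall_support_dvd_C _) ?_
  have hfac : ∀ i ∈ (univ : Finset σ),
      ∀ m ∈ ((X i + C (b i)) ^ (d i) : MvPolynomial σ K).support, ∀ i', p ^ c ∣ m i' := by
    intro i _
    obtain ⟨k, hk⟩ := hf d hd i
    rw [hk, pow_mul, add_pow_char_pow, ← map_pow]
    refine forall_support_dvd_pow (forall_support_add (forall_support_X_pow fun i' => ?_)
      (forall_support_dvd_C _)) k
    rw [Finsupp.single_apply]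
    split_ifs
    · exact dvd_rfl
    · exact dvd_zero _
  have := forall_support_prod (P := fun _ m => ∀ i, p ^ c ∣ m i)
    (fun i => by rw [Finsupp.zero_apply]; exact dvd_zero _)
    (fun _ _ a c ha hc i => by rw [Finsupp.add_apply]; exact dvd_add (ha i) (hc i))
    univ (fun i => (X i + C (b i)) ^ (d i)) (fun _ => 0) hfac
  exact this

/-! ### The dehomogenisation without translation (`y_j ↦ 1`) and homogeneous polynomials -/

/-- `(c·y^d)(y_j ↦ 1) = c·y^{d − d_j e_j}`. [folklore] -/
theorem flat_monomial (j : σ) (d : σ →₀ ℕ) (c : K) :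
    aeval (fun i => if i = j then (1 : MvPolynomial σ K) else X i) (monomial d c) =
      monomial (d.erase j) c := by
  rw [aeval_monomial, algebraMap_eq, Finsupp.prod_pow, monomial_eq, Finsupp.prod_pow]
  congr 1
  refine Finset.prod_congr rfl fun i _ => ?_
  rw [Finsupp.erase_apply]
  by_cases hij : i = j
  · rw [if_pos hij, if_pos hij, one_pow, pow_zero]
  · rw [if_neg hij, if_neg hij]

omit [Fintype σ] in
/-- A homogeneous exponent is determined by its entries off `j` (and the degree). [folklore] -/
theorem eq_of_erase_eq_of_degree_eq [Fintype σ] {j : σ} {d d' : σ →₀ ℕ}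
    (he : d.erase j = d'.erase j) (hdeg : d.degree = d'.degree) : d = d' := by
  have h1 := degree_eq_add_sum_erase j d
  have h2 := degree_eq_add_sum_erase j d'
  have h3 : ∑ i ∈ univ.erase j, d i = ∑ i ∈ univ.erase j, d' i := by
    refine Finset.sum_congr rfl fun i hi => ?_
    have := congrArg (fun f => f i) he
    simp only [Finsupp.erase_apply, if_neg (Finset.ne_of_mem_erase hi)] at this
    exact this
  ext i
  by_cases hij : i = j
  · subst hij; omega
  · have := congrArg (fun f => f i) he
    simp only [Finsupp.erase_apply, if_neg hij] at this
    exact this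

/-- The coefficients of `P(y_j ↦ 1)` for a homogeneous `P`: `[y^{d − d_j e_j}] P(y_j ↦ 1) =
[y^d] P`. [folklore] -/
theorem coeff_erase_flat_of_isHomogeneous (j : σ) (P : MvPolynomial σ K) {o : ℕ}
    (hP : ∀ d ∈ P.support, d.degree = o) {d : σ →₀ ℕ} (hd : d ∈ P.support) :
    coeff (d.erase j) (aeval (fun i => if i = j then (1 : MvPolynomial σ K) else X i) P) =
      coeff d P := by
  conv_lhs => rw [P.as_sum, map_sum]
  simp_rw [flat_monomial]
  refine coeff_sum_monomial_of_injOn P.support (fun d => d.erase j) (fun d => coeff d P) hd ?_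
  intro d' hd' _ he
  refine eq_of_erase_eq_of_degree_eq he ?_
  rw [hP d' hd', hP d hd]

omit [Fintype σ] in
/-- `Φ_{j,b} = translate b ∘ (y_j ↦ 1)`. [folklore] -/
theorem translate_flat (j : σ) (b : σ → K) (P : MvPolynomial σ K) :
    translate b (aeval (fun i => if i = j then (1 : MvPolynomial σ K) else X i) P) =
      aeval (fun i => if i = j then (1 : MvPolynomial σ K) else X i + C (b i)) P := by
  unfold translate
  rw [← AlgHom.comp_apply, MvPolynomial.comp_aeval]
  have hfun : (fun i => aeval (fun i => (X i + C (b i) : MvPolynomial σ K))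
      (if i = j then (1 : MvPolynomial σ K) else X i)) =
      fun i => if i = j then (1 : MvPolynomial σ K) else X i + C (b i) := by
    funext i
    by_cases hij : i = j
    · rw [if_pos hij, if_pos hij, map_one]
    · rw [if_neg hij, if_neg hij, aeval_X]
  rw [hfun]

/-- **Rehomogenisation.** If `P` is homogeneous of degree `o`, `p^c ∣ o`, and the dehomogenisation
`Φ_{j,b}(P)` is an exponent-`p^c` polynomial, then so is `P` (translate back by `−b`, then read
`P` off `P(y_j ↦ 1)` monomial by monomial, the `j`-th exponent being `o − Σ_{i≠j} d_i`).
[folklore] -/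
theorem forall_dvd_of_dehomog (p : ℕ) [hp : Fact p.Prime] [CharP K p] (c : ℕ) (j : σ)
    (b : σ → K) (P : MvPolynomial σ K) {o : ℕ} (hP : ∀ d ∈ P.support, d.degree = o)
    (ho : p ^ c ∣ o)
    (hΦ : ∀ m ∈ (aeval (fun i => if i = j then (1 : MvPolynomial σ K) else X i + C (b i)) P).support,
      ∀ i, p ^ c ∣ m i) :
    ∀ d ∈ P.support, ∀ i, p ^ c ∣ d i := by
  intro d hd
  have hflat : ∀ m ∈ (aeval (fun i => if i = j then (1 : MvPolynomial σ K) else X i) P).support,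
      ∀ i, p ^ c ∣ m i := by
    rw [← translate_neg_translate b (aeval _ P), translate_flat]
    exact forall_support_dvd_translate p c _ hΦ
  have hmem : d.erase j ∈ (aeval (fun i => if i = j then (1 : MvPolynomial σ K) else X i) P).support := by
    rw [MvPolynomial.mem_support_iff, coeff_erase_flat_of_isHomogeneous j P hP hd]
    exact MvPolynomial.mem_support_iff.mp hd
  have h1 := hflat _ hmem
  have hsum : p ^ c ∣ ∑ i ∈ univ.erase j, d i := by
    refine Finset.dvd_sum fun i hi => ?_
    have := h1 i
    rwa [Finsupp.erase_apply, if_neg (Finset.ne_of_mem_erase hi)] at this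
  intro i
  by_cases hij : i = j
  · subst hij
    have h2 := degree_eq_add_sum_erase i d
    rw [hP d hd] at h2
    have : d i = o - ∑ k ∈ univ.erase i, d k := by omega
    rw [this]
    exact Nat.dvd_sub ho hsum
  · have := h1 i
    rwa [Finsupp.erase_apply, if_neg hij] at this

/-! ### The arithmetic of the complementary exponents `a_i = (−ρ_i) mod P₁` -/

omit [Fintype σ] [DecidableEq σ] in
/-- `ρ_i + a_i ≡ 0 (mod P₁)`, `a_i < P₁`, and `a_i + (ρ_i mod P₁) = [P₁ ∤ ρ_i]·P₁`. [folklore] -/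
theorem compl_mod_props {P₁ : ℕ} (hP₁ : 0 < P₁) (x : ℕ) :
    P₁ ∣ x + (P₁ - x % P₁) % P₁ ∧ (P₁ - x % P₁) % P₁ < P₁ ∧
      (P₁ - x % P₁) % P₁ + x % P₁ = if P₁ ∣ x then 0 else P₁ := by
  have hlt : x % P₁ < P₁ := Nat.mod_lt x hP₁
  by_cases h : P₁ ∣ x
  · have h0 : x % P₁ = 0 := Nat.mod_eq_zero_of_dvd h
    rw [if_pos h, h0, Nat.sub_zero, Nat.mod_self, add_zero]
    exact ⟨h, hP₁, rfl⟩
  · have hne : x % P₁ ≠ 0 := fun h0 => h (Nat.dvd_of_mod_eq_zero h0)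
    have h1 : (P₁ - x % P₁) % P₁ = P₁ - x % P₁ := Nat.mod_eq_of_lt (by omega)
    rw [if_neg h, h1]
    refine ⟨?_, by omega, by omega⟩
    have h2 : x + (P₁ - x % P₁) = P₁ * (x / P₁) + P₁ := by
      have := Nat.div_add_mod x P₁
      omega
    rw [h2]
    exact dvd_add (dvd_mul_right _ _) dvd_rfl

omit [Fintype σ] [DecidableEq σ] in
/-- **The complementary exponents of a violated residue inequality.** For `P₁ = p^{ℓ+1}`, a set
`T` and multiplicities `ρ`, put `a_i := (−ρ_i) mod P₁`. Then `Σ_{i∈T} a_i + Σ_{i∈T} (ρ_i mod P₁)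
= b·P₁` (`b` the number of `i ∈ T` with `P₁ ∤ ρ_i`); if the residue inequality
`Σ_{i∈T} (ρ_i mod P₁) ≤ (b − 1)·P₁` FAILS then `Σ_{i∈T} a_i < P₁`, and if moreover `P₁ ∣ o`,
`Σ_{i∈T} ρ_i ≤ o`, then `Σ_{i∈T} a_i = (o − Σ_{i∈T} ρ_i) mod P₁`. [cite: HauserPerlega2019PRIMS, §5 (proof of (6))] -/
theorem sum_compl_mod_eq_of_not_residueInequality (p ℓ : ℕ) (hp : 0 < p) (T : Finset σ)
    (ρ : σ → ℕ) {o : ℕ} (ho : p ^ (ℓ + 1) ∣ o) (hρo : ∑ i ∈ T, ρ i ≤ o)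
    (hneg : ¬ HauserPerlega2019.ResidueInequality p ℓ T ρ) :
    ∑ i ∈ T, (p ^ (ℓ + 1) - ρ i % p ^ (ℓ + 1)) % p ^ (ℓ + 1) < p ^ (ℓ + 1) ∧
      ∑ i ∈ T, (p ^ (ℓ + 1) - ρ i % p ^ (ℓ + 1)) % p ^ (ℓ + 1) =
        (o - ∑ i ∈ T, ρ i) % p ^ (ℓ + 1) := by
  set P₁ : ℕ := p ^ (ℓ + 1) with hP₁def
  have hP₁ : 0 < P₁ := pow_pos hp _
  set A : ℕ := ∑ i ∈ T, (P₁ - ρ i % P₁) % P₁ with hA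
  set R : ℕ := ∑ i ∈ T, ρ i % P₁ with hR
  set S : ℕ := ∑ i ∈ T, ρ i with hS
  -- `A + R = b·P₁`
  have hAR : A + R = (T.filter fun i => ¬ P₁ ∣ ρ i).card * P₁ := by
    rw [hA, hR, ← Finset.sum_add_distrib, Finset.card_filter, Finset.sum_mul]
    refine Finset.sum_congr rfl fun i _ => ?_
    rw [(compl_mod_props hP₁ (ρ i)).2.2]
    split_ifs <;> simp
  -- the violated inequality: `(b − 1)·P₁ < R` in `ℤ`
  have hlt : A < P₁ := by
    unfold HauserPerlega2019.ResidueInequality at hneg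
    rw [not_le] at hneg
    have h1 : ((A : ℕ) : ℤ) + R = ((T.filter fun i => ¬ P₁ ∣ ρ i).card : ℤ) * (P₁ : ℕ) := by
      exact_mod_cast hAR
    have h2 := hneg
    push_cast at h1 h2 ⊢
    nlinarith [h1, h2]
  refine ⟨hlt, ?_⟩
  -- `A ≡ o − S (mod P₁)`
  have hSR : S ≡ R [MOD P₁] := by
    show (∑ i ∈ T, ρ i) % P₁ = (∑ i ∈ T, ρ i % P₁) % P₁
    exact Finset.sum_nat_mod T P₁ ρ
  have hAR' : A + R ≡ 0 [MOD P₁] := by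
    rw [hAR, Nat.ModEq, Nat.mul_mod_left, Nat.zero_mod]
  have ho' : o ≡ 0 [MOD P₁] := (Nat.modEq_zero_iff_dvd.mpr ho)
  have h3 : (o - S) + S = o := Nat.sub_add_cancel hρo
  have h4 : (o - S) + S ≡ A + S [MOD P₁] := by
    rw [h3]
    calc o ≡ 0 [MOD P₁] := ho'
      _ ≡ A + R [MOD P₁] := hAR'.symm
      _ ≡ A + S [MOD P₁] := Nat.ModEq.add_left A hSR.symm
  have h5 : o - S ≡ A [MOD P₁] := Nat.ModEq.add_right_cancel' S h4
  rw [Nat.ModEq, Nat.mod_eq_of_lt hlt] at h5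
  exact h5.symm

/-! ### Truncations: low parts of products with an exponent-`P₁` factor -/

omit [Fintype σ] in
/-- A multiple of `P₁` exceeding the multiple `P₁·k` is at least `P₁·k + P₁`. [folklore] -/
theorem mul_add_le_of_dvd_of_lt {P₁ k x : ℕ} (hx : P₁ ∣ x) (hlt : P₁ * k < x) : P₁ * k + P₁ ≤ x := by
  obtain ⟨t, rfl⟩ := hx
  have : k < t := Nat.lt_of_mul_lt_mul_left hlt
  nlinarith

omit [DecidableEq σ] in
/-- **Low part of a product with an exponent-`P₁` factor.** If every monomial of `A` has
degree `≤ α < P₁`, `ŭ ≡ α (mod P₁)`, and `C` is an exponent-`P₁` polynomial, then the part of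
`A·C` of degree `≤ ŭ` is `A` times the part of `C` of degree `≤ ŭ − α` (the degrees of the
monomials of `C` are multiples of `P₁`, so none lies strictly between `ŭ − α` and
`ŭ − α + P₁ > ŭ`). [folklore] -/
theorem lowPart_mul_of_forall_dvd {P₁ α ŭ : ℕ} (hα : α < P₁) (hŭ : ŭ % P₁ = α)
    (A C' : MvPolynomial σ K) (hA : ∀ m ∈ A.support, m.degree ≤ α)
    (hC : ∀ m ∈ C'.support, ∀ i, P₁ ∣ m i) :
    ∑ n ∈ Finset.range (ŭ + 1), homogeneousComponent n (A * C') =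
      A * ∑ n ∈ Finset.range (ŭ - α + 1), homogeneousComponent n C' := by
  classical
  set B := ∑ n ∈ Finset.range (ŭ - α + 1), homogeneousComponent n C' with hBdef
  have hsplit : A * C' = A * B + A * (C' - B) := by ring
  have hŭα : ŭ - α = P₁ * (ŭ / P₁) := by
    have := Nat.div_add_mod ŭ P₁
    omega
  have hαŭ : α ≤ ŭ := hŭ ▸ Nat.mod_le ŭ P₁
  -- degrees of the two pieces
  have hlow : ∀ m ∈ (A * B).support, m.degree ≤ ŭ := by
    refine forall_support_mul (P := fun m => m.degree ≤ α) (Q := fun m => m.degree ≤ ŭ - α)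
      (S := fun m => m.degree ≤ ŭ) (fun a c ha hc => by rw [map_add]; omega) hA ?_
    intro m hm
    exact (mem_support_lowPart hm).2
  have hhigh : ∀ m ∈ (A * (C' - B)).support, ŭ < m.degree := by
    refine forall_support_mul (P := fun m => m.degree ≤ α) (Q := fun m => ŭ - α + P₁ ≤ m.degree)
      (S := fun m => ŭ < m.degree) (fun a c ha hc => by rw [map_add]; omega) hA ?_
    intro m hm
    have h1 := lt_degree_of_mem_support_sub_lowPart hm
    have h2 : m ∈ C'.support := by
      have := support_sub σ C' B hm
      rcases Finset.mem_union.mp this with h | h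
      · exact h
      · exact (mem_support_lowPart h).1
    have h3 : P₁ ∣ m.degree := dvd_degree_of_forall_dvd (hC m h2)
    rw [hŭα] at h1 ⊢
    exact mul_add_le_of_dvd_of_lt h3 h1
  rw [hsplit, Finset.sum_congr rfl fun n _ => map_add (homogeneousComponent n) _ _,
    Finset.sum_add_distrib, lowPart_eq_self_of_forall_le _ _ hlow,
    lowPart_eq_zero_of_forall_lt _ _ hhigh, add_zero]

omit [Fintype σ] [DecidableEq σ] in
/-- **Division by a unit with exponent-`P₁` correction, truncated.** Abstract form of the step
"`G = ⌊U⁻¹·N⌋_ŭ`" of [HP19 PRIMS] (5): if `X` has all monomials of degree `≤ ŭ`,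
`W·V = 1 − Y'` with `Y'` of order `> ŭ`, `A·Pf = W·X`, and `Pf = N + H` with `H` of order `> ŭ`,
then `X` is the part of degree `≤ ŭ` of `A·(V·N)`. [cite: HauserPerlega2019PRIMS, §3 Theorem (5)] -/
theorem eq_lowPart_of_mul_eq {ŭ : ℕ} (X W V Y' A Pf N H : MvPolynomial σ K)
    (hX : ∀ m ∈ X.support, m.degree ≤ ŭ) (hWV : W * V = 1 - Y')
    (hY' : ∀ m ∈ Y'.support, ŭ < m.degree) (hAP : A * Pf = W * X) (hNH : Pf = N + H)
    (hH : ∀ m ∈ H.support, ŭ < m.degree) :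
    X = ∑ n ∈ Finset.range (ŭ + 1), homogeneousComponent n (A * (V * N)) := by
  classical
  have hid : X = A * (V * N) + (V * (A * H) + Y' * X) := by
    linear_combination (-X) * hWV - V * hAP + (V * A) * hNH
  have hrest : ∀ m ∈ (V * (A * H) + Y' * X).support, ŭ < m.degree := by
    refine forall_support_add ?_ ?_
    · refine forall_support_mul (P := fun _ => True) (Q := fun m => ŭ < m.degree)
        (S := fun m => ŭ < m.degree) (fun a c _ hc => by rw [map_add]; omega) (fun _ _ => trivial) ?_
      exact forall_support_mul (P := fun _ => True) (Q := fun m => ŭ < m.degree)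
        (S := fun m => ŭ < m.degree) (fun a c _ hc => by rw [map_add]; omega) (fun _ _ => trivial) hH
    · exact forall_support_mul (P := fun m => ŭ < m.degree) (Q := fun _ => True)
        (S := fun m => ŭ < m.degree) (fun a c ha _ => by rw [map_add]; omega) hY' (fun _ _ => trivial)
  conv_lhs => rw [← lowPart_eq_self_of_forall_le ŭ X hX, hid]
  rw [Finset.sum_congr rfl fun n _ => map_add (homogeneousComponent n) _ _, Finset.sum_add_distrib,
    lowPart_eq_zero_of_forall_lt _ _ hrest, add_zero]

/-! ### The main algebraic step -/

variable [DecidableEq K]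

/-- **[HP19 PRIMS] (4) ⟹ (6), contrapositive, as pure algebra.** Let `P` be homogeneous of degree
`o` with `p^{ℓ+1} ∣ o`, `b` a point of the `y_j`-chart (`T = {j} ∪ {i : b_i ≠ 0}` its lost
components), `ρ` multiplicities with `y_i^{ρ_i} ∣ P` for `i ∈ T` and `Σ_{i∈T} ρ_i ≤ o`. If every
monomial of the dehomogenisation `Φ_{j,b}(P)` of degree `≤ o − Σ_{i∈T} ρ_i` is an
exponent-`p^{ℓ+1}` monomial (assertion (4) at level `p^{ℓ+1}`) and the residue inequality (6)
`Σ_{i∈T} (ρ_i mod p^{ℓ+1}) ≤ (b − 1)·p^{ℓ+1}` FAILS, then `P` is an exponent-`p^{ℓ+1}`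
polynomial (`P ∈ K[y₁^{p^{ℓ+1}}, …, y_n^{p^{ℓ+1}}]`). Route (Hauser–Perlega's proof of (5)–(6),
with the coefficient ideal replaced by the polynomial identity `P = y^ρ·G`): with
`a_i = (−ρ_i) mod p^{ℓ+1}`, `U = Φ(y^ρ)`, `A = Φ(y^a)`, the product `W = U·A = Φ(y^{ρ+a})` is a
`p^{ℓ+1}`-th power with non-zero constant term; `Φ(G) = ⌊A·W⁻¹·N⌋_ŭ` (`N` the part of `Φ(P)` of
degree `≤ ŭ`, `W⁻¹` a truncated geometric series) `= A·B` with `B` an exponent-`p^{ℓ+1}` polynomial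
because `deg A ≤ Σ a_i = ŭ mod p^{ℓ+1}` — this is where the violated inequality enters — hence
`Φ(P) = W·B` is exponent-`p^{ℓ+1}`, and so is `P` by rehomogenisation.
[cite: HauserPerlega2019PRIMS, §3 Theorem (5)–(6) and §5 (proof)] -/
theorem forall_dvd_of_not_residueInequality (p : ℕ) [hp : Fact p.Prime] [CharP K p] (ℓ : ℕ)
    (j : σ) (b : σ → K) (P : MvPolynomial σ K) {o : ℕ} (hP : ∀ d ∈ P.support, d.degree = o)
    (hPo : p ^ (ℓ + 1) ∣ o) (ρ : σ → ℕ)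
    (hρ : ∀ d ∈ P.support, ∀ i ∈ lostComponents j b, ρ i ≤ d i)
    (hρo : ∑ i ∈ lostComponents j b, ρ i ≤ o)
    (h4 : ∀ m ∈ (aeval (fun i => if i = j then (1 : MvPolynomial σ K) else X i + C (b i)) P).support,
      m.degree + ∑ i ∈ lostComponents j b, ρ i ≤ o → ∀ i, p ^ (ℓ + 1) ∣ m i)
    (hneg : ¬ HauserPerlega2019.ResidueInequality p ℓ (lostComponents j b) ρ) :
    ∀ d ∈ P.support, ∀ i, p ^ (ℓ + 1) ∣ d i := by
  classical
  set T := lostComponents j b with hT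
  set P₁ : ℕ := p ^ (ℓ + 1) with hP₁
  have hP₁pos : 0 < P₁ := pow_pos hp.out.pos _
  set Φ : MvPolynomial σ K →ₐ[K] MvPolynomial σ K :=
    aeval (fun i => if i = j then (1 : MvPolynomial σ K) else X i + C (b i)) with hΦ
  -- the multiplicity exponent `ρT = ρ` on `T`, `0` off `T`
  obtain ⟨ρT, hρTi⟩ : ∃ ρT : σ →₀ ℕ, ∀ i, ρT i = if i ∈ T then ρ i else 0 :=
    ⟨Finsupp.equivFunOnFinite.symm (fun i => if i ∈ T then ρ i else 0),
      fun i => by rw [Finsupp.coe_equivFunOnFinite_symm]⟩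
  have hρTle : ∀ d ∈ P.support, ρT ≤ d := by
    intro d hd
    rw [Finsupp.le_def]
    intro i
    rw [hρTi]
    split_ifs with hi
    · exact hρ d hd i hi
    · exact Nat.zero_le _
  have hρTdeg : ρT.degree = ∑ i ∈ T, ρ i := by
    rw [Finsupp.degree_eq_sum]
    simp_rw [hρTi]
    rw [Finset.sum_ite_mem, Finset.univ_inter]
  set ŭ : ℕ := o - ∑ i ∈ T, ρ i with hŭ
  -- `P = y^ρT · G`, `G` homogeneous of degree `ŭ`
  set G : MvPolynomial σ K := ∑ d ∈ P.support, monomial (d - ρT) (coeff d P) with hG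
  have hPG : P = monomial ρT 1 * G := by
    rw [hG, Finset.mul_sum]
    conv_lhs => rw [P.as_sum]
    refine Finset.sum_congr rfl fun d hd => ?_
    rw [monomial_mul, one_mul, add_tsub_cancel_of_le (hρTle d hd)]
  have hGdeg : ∀ g ∈ G.support, g.degree ≤ ŭ := by
    intro g hg
    obtain ⟨d, hd, -, rfl⟩ := exists_of_mem_support_sum_monomial _ _ _ hg
    have h1 : (d - ρT) + ρT = d := tsub_add_cancel_of_le (hρTle d hd)
    have h2 := congrArg Finsupp.degree h1
    rw [map_add, hP d hd, hρTdeg] at h2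
    omega
  have hΦGdeg : ∀ m ∈ (Φ G).support, m.degree ≤ ŭ := degree_le_of_mem_support_dehomog j b G ŭ hGdeg
  -- the complementary exponents `a_i = (−ρ_i) mod P₁`
  obtain ⟨aF, haFi⟩ : ∃ aF : σ →₀ ℕ, ∀ i, aF i = (P₁ - ρT i % P₁) % P₁ :=
    ⟨Finsupp.equivFunOnFinite.symm (fun i => (P₁ - ρT i % P₁) % P₁),
      fun i => by rw [Finsupp.coe_equivFunOnFinite_symm]⟩
  have haprop : ∀ i, P₁ ∣ ρT i + aF i ∧ aF i < P₁ := fun i => by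
    rw [haFi]
    exact ⟨(compl_mod_props hP₁pos (ρT i)).1, (compl_mod_props hP₁pos (ρT i)).2.1⟩
  have ha_off : ∀ i, i ∉ T → aF i = 0 := by
    intro i hi
    rw [haFi, hρTi, if_neg hi, Nat.zero_mod, Nat.sub_zero, Nat.mod_self]
  have ha_on : ∀ i ∈ T, aF i = (P₁ - ρ i % P₁) % P₁ := by
    intro i hi
    rw [haFi, hρTi, if_pos hi]
  obtain ⟨nF, hnFi⟩ : ∃ nF : σ →₀ ℕ, ∀ i, nF i = (ρT i + aF i) / P₁ :=
    ⟨Finsupp.equivFunOnFinite.symm (fun i => (ρT i + aF i) / P₁),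
      fun i => by rw [Finsupp.coe_equivFunOnFinite_symm]⟩
  have hsum_n : ρT + aF = P₁ • nF := by
    ext i
    rw [Finsupp.add_apply, Finsupp.smul_apply, smul_eq_mul, hnFi, Nat.mul_div_cancel' (haprop i).1]
  -- `U`, `A`, `W = U·A`, a `P₁`-th power with invertible constant term
  set U : MvPolynomial σ K := Φ (monomial ρT 1) with hU
  set A : MvPolynomial σ K := Φ (monomial aF 1) with hA
  set W : MvPolynomial σ K := Φ (monomial (ρT + aF) 1) with hW
  have hWUA : W = U * A := by
    rw [hW, hU, hA, ← map_mul, monomial_mul, one_mul]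
  have hWpow : W = (Φ (monomial nF 1)) ^ P₁ := by
    rw [hW, ← map_pow, monomial_pow, one_pow, hsum_n]
  have hWdvd : ∀ m ∈ W.support, ∀ i, P₁ ∣ m i := by
    rw [hWpow]
    exact forall_support_pow_char_pow p (ℓ + 1) _
  have hW0 : constantCoeff W ≠ 0 := by
    rw [hW, hΦ, dehomog_monomial, map_mul, constantCoeff_C, one_mul, map_prod]
    refine Finset.prod_ne_zero_iff.mpr fun i hi => ?_
    rw [map_pow, map_add, constantCoeff_X, constantCoeff_C, zero_add]
    by_cases he : (ρT + aF) i = 0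
    · rw [he, pow_zero]; exact one_ne_zero
    · refine pow_ne_zero _ fun hbi => he ?_
      have hiT : i ∉ T := by
        rw [hT, lostComponents, Finset.mem_filter]
        push Not
        exact fun _ => ⟨Finset.ne_of_mem_erase hi, hbi⟩
      rw [Finsupp.add_apply, hρTi, if_neg hiT, ha_off i hiT]
  -- the truncated inverse `V` of `W`: `W·V = 1 − Y^{ŭ+1}`
  set w₀ : K := constantCoeff W with hw₀
  set Y : MvPolynomial σ K := 1 - C w₀⁻¹ * W with hY
  set V : MvPolynomial σ K := C w₀⁻¹ * ∑ t ∈ Finset.range (ŭ + 1), Y ^ t with hV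
  have hWV : W * V = 1 - Y ^ (ŭ + 1) := by
    rw [← mul_neg_geom_sum Y (ŭ + 1), hV, hY]
    ring
  have hY0 : constantCoeff Y = 0 := by
    rw [hY, map_sub, map_one, map_mul, constantCoeff_C, ← hw₀, inv_mul_cancel₀ hW0, sub_self]
  have hYpow : ∀ m ∈ (Y ^ (ŭ + 1)).support, ŭ < m.degree := by
    have := forall_support_pow (P := fun n m => n ≤ m.degree) (n := 1) (by rw [map_zero])
      (fun _ _ a c ha hc => by rw [map_add]; omega)
      (one_le_degree_of_constantCoeff_eq_zero hY0) (ŭ + 1)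
    intro m hm
    have := this m hm
    omega
  have hYdvd : ∀ m ∈ Y.support, ∀ i, P₁ ∣ m i := by
    rw [hY]
    refine forall_support_sub ?_ (forall_support_dvd_mul (forall_support_dvd_C _) hWdvd)
    exact forall_support_one (P := fun m => ∀ i, P₁ ∣ m i)
      (fun i => by rw [Finsupp.zero_apply]; exact dvd_zero _)
  have hVdvd : ∀ m ∈ V.support, ∀ i, P₁ ∣ m i := by
    rw [hV]
    exact forall_support_dvd_mul (forall_support_dvd_C _)
      (forall_support_sum _ _ fun t _ => forall_support_dvd_pow hYdvd t)
  -- the low part `N` of `Φ P` (exponent-`P₁` by (4)) and the high part `H`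
  set N : MvPolynomial σ K := ∑ n ∈ Finset.range (ŭ + 1), homogeneousComponent n (Φ P) with hN
  set H : MvPolynomial σ K := Φ P - N with hH
  have hNdvd : ∀ m ∈ N.support, ∀ i, P₁ ∣ m i := by
    intro m hm
    obtain ⟨h1, h2⟩ := mem_support_lowPart hm
    exact h4 m h1 (by omega)
  have hHdeg : ∀ m ∈ H.support, ŭ < m.degree := fun m hm => lt_degree_of_mem_support_sub_lowPart hm
  have hNH : Φ P = N + H := by rw [hH]; ring
  -- `Φ G = ⌊A·V·N⌋_ŭ = A·B`
  have hAP : A * Φ P = W * Φ G := by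
    rw [hPG, map_mul, hWUA, ← hU]
    ring
  have hΦG : Φ G = ∑ n ∈ Finset.range (ŭ + 1), homogeneousComponent n (A * (V * N)) :=
    eq_lowPart_of_mul_eq (Φ G) W V (Y ^ (ŭ + 1)) A (Φ P) N H hΦGdeg hWV hYpow hAP hNH hHdeg
  set α : ℕ := ∑ i ∈ T, aF i with hα
  have hAdeg : ∀ m ∈ A.support, m.degree ≤ α := by
    have h1 : ∀ m ∈ A.support, m.degree ≤ aF.degree := by
      rw [hA, hΦ]
      refine degree_le_of_mem_support_dehomog j b _ _ ?_
      refine forall_support_monomial (P := fun m => m.degree ≤ aF.degree) le_rfl _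
    have h2 : aF.degree = α := by
      rw [Finsupp.degree_eq_sum, hα]
      symm
      refine Finset.sum_subset (Finset.subset_univ T) fun i _ hi => ha_off i hi
    intro m hm
    rw [← h2]
    exact h1 m hm
  -- the arithmetic of the violated inequality: `α = ŭ mod P₁ < P₁`
  have harith := sum_compl_mod_eq_of_not_residueInequality p ℓ hp.out.pos T ρ hPo hρo hneg
  have hαeq : α = ∑ i ∈ T, (P₁ - ρ i % P₁) % P₁ := Finset.sum_congr rfl ha_on
  have hαlt : α < P₁ := by rw [hαeq]; exact harith.1
  have hαmod : ŭ % P₁ = α := by rw [hαeq, hŭ]; exact harith.2.symm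
  have hVNdvd : ∀ m ∈ (V * N).support, ∀ i, P₁ ∣ m i := forall_support_dvd_mul hVdvd hNdvd
  have hlow := lowPart_mul_of_forall_dvd hαlt hαmod A (V * N) hAdeg hVNdvd
  set B : MvPolynomial σ K := ∑ n ∈ Finset.range (ŭ - α + 1), homogeneousComponent n (V * N)
    with hB
  have hBdvd : ∀ m ∈ B.support, ∀ i, P₁ ∣ m i := fun m hm => hVNdvd m (mem_support_lowPart hm).1
  have hΦG' : Φ G = A * B := by rw [hΦG, hlow]
  -- `Φ P = W·B` is exponent-`P₁`; rehomogenise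
  have hΦP : Φ P = W * B := by
    rw [hPG, map_mul, hΦG', ← mul_assoc, ← hU, ← hWUA]
  have hΦPdvd : ∀ m ∈ (Φ P).support, ∀ i, P₁ ∣ m i := by
    rw [hΦP]
    exact forall_support_dvd_mul hWdvd hBdvd
  exact forall_dvd_of_dehomog p (ℓ + 1) j b P hP hPo hΦPdvd

end Algebra

/-! ## 4. [HP19 PRIMS] §3 Theorem (6) and Comment (d) for the point blow-ups of `z^{pᵉ} + F(y)`,
every `e`, every dimension -/

section Main

variable {σ : Type*} {K : Type*} [Field K] [Fintype σ] [DecidableEq σ] [DecidableEq K]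
variable (p : ℕ) [hp : Fact p.Prime] [CharP K p]

/-- **[HP19 PRIMS] assertion (6), with Hauser–Perlega's multiplicities.** Let `q = pᵉ`, `s = (F, r)`
a state with `ord₀ F = o ≥ q` and `y^r ∣ F`, and suppose the shade INCREASES at the point `b` of
the `y_j`-chart (`b_j = 0`); let `T = {j} ∪ {i : b_i ≠ 0}` be the lost components. Let
`ρ_i` (`i ∈ T`) be any multiplicities between the state's `r_i` and the orders `ord_{y_i} In F` of
the initial form along `y_i` (Hauser–Perlega's "`r_i = ord_{(x_i)} F` for `i ∈ T`", read in fixed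
coordinates). Then for every level `k < e` at which the initial form is not a `p^{k+1}`-th power
(some initial exponent is not divisible by `p^{k+1}`; in the source `k = ℓ` is the largest integer
with `In F` a `p^ℓ`-th power, and the proof printed there works verbatim for every such `k`), the
residues `ρ̄_i` of the `ρ_i` modulo `p^{k+1}` satisfy the ARITHMETIC INEQUALITY
`Σ_{i ∈ T} ρ̄_i ≤ (b − 1)·p^{k+1}`, `b` the number of `i ∈ T` with `ρ_i ≢ 0 (mod p^{k+1})` — the
tree's predicate `HauserPerlega2019.ResidueInequality p k T ρ` of `PointBlowupShade.lean`, typed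
there and asserted nowhere until now. Fixed coordinates: a translated NON-exceptional variable
(which Hauser–Perlega remove by the coordinate change `x_i ↦ x_i + t_i x_1`, §2) may belong to `T`;
it occurs in `In F` with `q`-divisible exponents only (`pow_dvd_apply_of_shadeIncreases_of_nonexceptional`),
so it contributes `0` to both sides. [cite: HauserPerlega2019PRIMS, §3 Theorem (6)] -/
theorem residueInequality_of_shadeIncreases_of_le {e : ℕ} (j : σ) (b : σ → K) (hbj : b j = 0)
    (s : State σ K) {o : ℕ} (ho : ordZero s.F = o) (hqo : p ^ e ≤ o)
    (hr : ∀ d ∈ s.F.support, s.r ≤ d) (hinc : ShadeIncreases (p ^ e) j b s)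
    (ρ : σ → ℕ) (hρr : ∀ i ∈ lostComponents j b, s.r i ≤ ρ i)
    (hρd : ∀ d ∈ s.F.support, d.degree = o → ∀ i ∈ lostComponents j b, ρ i ≤ d i)
    {k : ℕ} (hk : k < e) (hlevel : ∃ d ∈ s.F.support, d.degree = o ∧ ∃ i, ¬ p ^ (k + 1) ∣ d i) :
    HauserPerlega2019.ResidueInequality p k (lostComponents j b) ρ := by
  classical
  by_contra hneg
  set P : MvPolynomial σ K := homogeneousComponent o s.F with hPdef
  have hPsupp : ∀ d ∈ P.support, d ∈ s.F.support ∧ d.degree = o := by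
    intro d hd
    rw [MvPolynomial.mem_support_iff, hPdef, coeff_homogeneousComponent] at hd
    split_ifs at hd with h
    · exact ⟨MvPolynomial.mem_support_iff.mpr hd, h⟩
    · exact absurd rfl hd
  have hP : ∀ d ∈ P.support, d.degree = o := fun d hd => (hPsupp d hd).2
  -- `q ∣ o` (Probe 1), hence `p^{k+1} ∣ o`
  have hqo' : p ^ e ∣ o := by
    by_contra hndvd
    exact absurd hinc (not_lt.mpr (shade_step_le_of_not_dvd (p ^ e) j b hbj s ho hqo hr hndvd))
  have hPo : p ^ (k + 1) ∣ o := (pow_dvd_pow p (by omega)).trans hqo'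
  have hρ : ∀ d ∈ P.support, ∀ i ∈ lostComponents j b, ρ i ≤ d i :=
    fun d hd => hρd d (hPsupp d hd).1 (hPsupp d hd).2
  obtain ⟨d₀, hd₀, hd₀deg, i₀, hi₀⟩ := hlevel
  have hρo : ∑ i ∈ lostComponents j b, ρ i ≤ o := by
    calc ∑ i ∈ lostComponents j b, ρ i ≤ ∑ i ∈ lostComponents j b, d₀ i :=
          Finset.sum_le_sum fun i hi => hρd d₀ hd₀ hd₀deg i hi
      _ ≤ ∑ i, d₀ i :=
          Finset.sum_le_sum_of_subset_of_nonneg (Finset.subset_univ _) fun _ _ _ => Nat.zero_le _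
      _ = o := by rw [← Finsupp.degree_eq_sum, hd₀deg]
  have hrρ : ∑ i ∈ lostComponents j b, s.r i ≤ ∑ i ∈ lostComponents j b, ρ i :=
    Finset.sum_le_sum hρr
  have h4 : ∀ m ∈ (aeval (fun i => if i = j then (1 : MvPolynomial σ K) else X i + C (b i)) P).support,
      m.degree + ∑ i ∈ lostComponents j b, ρ i ≤ o → ∀ i, p ^ (k + 1) ∣ m i := by
    intro m hm hdeg i
    refine (pow_dvd_pow p (by omega : k + 1 ≤ e)).trans ?_
    exact dvd_of_shadeIncreases_of_mem_support_dehomog (p ^ e) j b hbj s ho hqo hr hinc hm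
      (by omega) i
  have hall := forall_dvd_of_not_residueInequality p k j b P hP hPo ρ hρ hρo h4 hneg
  have hd₀P : d₀ ∈ P.support := by
    rw [MvPolynomial.mem_support_iff, hPdef, coeff_homogeneousComponent, if_pos hd₀deg]
    exact MvPolynomial.mem_support_iff.mp hd₀
  exact hi₀ (hall d₀ hd₀P i₀)

/-- **[HP19 PRIMS] assertion (6) for the state's multiplicities**, every level `k < e` at which the
initial form has an exponent not divisible by `p^{k+1}`: if the shade increases at the point `b` of
the `y_j`-chart then `HauserPerlega2019.ResidueInequality p k (lostComponents j b) r` —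
`Σ_{i ∈ T} (r_i mod p^{k+1}) ≤ (b − 1)·p^{k+1}`, `T` the lost components, `b` the number of
`i ∈ T` with `p^{k+1} ∤ r_i`. (The state's `r_i` are AT MOST the printed `ord_{(x_i)} In F`; the
printed form is `residueInequality_of_shadeIncreases_of_le`. No cleanness hypothesis.)
[cite: HauserPerlega2019PRIMS, §3 Theorem (6)] -/
theorem residueInequality_of_shadeIncreases {e : ℕ} (j : σ) (b : σ → K) (hbj : b j = 0)
    (s : State σ K) {o : ℕ} (ho : ordZero s.F = o) (hqo : p ^ e ≤ o)
    (hr : ∀ d ∈ s.F.support, s.r ≤ d) (hinc : ShadeIncreases (p ^ e) j b s)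
    {k : ℕ} (hk : k < e) (hlevel : ∃ d ∈ s.F.support, d.degree = o ∧ ∃ i, ¬ p ^ (k + 1) ∣ d i) :
    HauserPerlega2019.ResidueInequality p k (lostComponents j b) s.r :=
  residueInequality_of_shadeIncreases_of_le p j b hbj s ho hqo hr hinc s.r (fun _ _ => le_rfl)
    (fun d hd _ i _ => Finsupp.le_def.mp (hr d hd) i) hk hlevel

/-- **[HP19 PRIMS] assertion (6) at the top level `p^{ℓ+1} = q = pᵉ` for a CLEANED state.** If
`F` is cleaned (no `q`-th-power monomials), its initial form is not a `q`-th power, so the level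
`k = e − 1` is always available: an increase of the shade at the point `b` of the `y_j`-chart forces
`Σ_{i ∈ T} (r_i mod q) ≤ (b − 1)·q`, `b = #{i ∈ T : q ∤ r_i}`.
[cite: HauserPerlega2019PRIMS, §3 Theorem (6)] -/
theorem residueInequality_of_shadeIncreases_of_clean {e : ℕ} (he : 1 ≤ e) (j : σ) (b : σ → K)
    (hbj : b j = 0) (s : State σ K) (hclean : deletePthPowers (p ^ e) s.F = s.F) {o : ℕ}
    (ho : ordZero s.F = o) (hqo : p ^ e ≤ o) (hr : ∀ d ∈ s.F.support, s.r ≤ d)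
    (hinc : ShadeIncreases (p ^ e) j b s) :
    HauserPerlega2019.ResidueInequality p (e - 1) (lostComponents j b) s.r := by
  obtain ⟨k, rfl⟩ : ∃ k, e = k + 1 := ⟨e - 1, by omega⟩
  rw [Nat.add_sub_cancel]
  refine residueInequality_of_shadeIncreases p j b hbj s ho hqo hr hinc (Nat.lt_succ_self k) ?_
  obtain ⟨⟨d₀, hd₀, hd₀deg⟩, -⟩ := (ordZero_eq_nat_iff _ _).mp ho
  have hd₀s : d₀ ∈ s.F.support := MvPolynomial.mem_support_iff.mpr hd₀
  have h1 := not_isPthPowerExponent_of_clean (p ^ (k + 1)) hclean hd₀s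
  rw [isPthPowerExponent_iff, not_forall] at h1
  exact ⟨d₀, hd₀s, hd₀deg, h1⟩

omit [Fintype σ] [DecidableEq σ] [DecidableEq K] hp [CharP K p] in
/-- **The residue inequality forces `b ≥ 2`.** `Σ_{i∈T} (r_i mod P₁) ≤ (b − 1)·P₁` (in `ℤ`) is
impossible for `b = 0` (right-hand side `−P₁ < 0`) and for `b = 1` (it would force all residues to
vanish, i.e. `b = 0`). [cite: HauserPerlega2019PRIMS, §3 Comment (d)] -/
theorem two_le_card_of_residueInequality (ℓ : ℕ) (hp0 : 0 < p) (T : Finset σ) (r : σ → ℕ)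
    (h : HauserPerlega2019.ResidueInequality p ℓ T r) :
    2 ≤ (T.filter fun i => ¬ p ^ (ℓ + 1) ∣ r i).card := by
  classical
  set P₁ : ℕ := p ^ (ℓ + 1) with hP₁
  have hP₁pos : 0 < P₁ := pow_pos hp0 _
  unfold HauserPerlega2019.ResidueInequality at h
  by_contra hlt
  rw [not_le] at hlt
  set c : ℕ := (T.filter fun i => ¬ P₁ ∣ r i).card with hc
  have hsum0 : ∑ i ∈ T, r i % P₁ = 0 := by
    have h1 : ((∑ i ∈ T, r i % P₁ : ℕ) : ℤ) ≤ ((c : ℤ) - 1) * (P₁ : ℕ) := h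
    have h2 : ((c : ℤ) - 1) * (P₁ : ℕ) ≤ 0 := by
      have : (c : ℤ) - 1 ≤ 0 := by
        have : c ≤ 1 := by omega
        linarith [show (c : ℤ) ≤ 1 by exact_mod_cast this]
      exact mul_nonpos_of_nonpos_of_nonneg this (by positivity)
    have h3 : ((∑ i ∈ T, r i % P₁ : ℕ) : ℤ) ≤ 0 := h1.trans h2
    exact_mod_cast le_antisymm (by exact_mod_cast h3) (Nat.zero_le _)
  have hall : ∀ i ∈ T, P₁ ∣ r i := by
    intro i hi
    exact Nat.dvd_of_mod_eq_zero ((Finset.sum_eq_zero_iff.mp hsum0) i hi)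
  have hc0 : c = 0 := by
    rw [hc, Finset.card_eq_zero, Finset.filter_eq_empty_iff]
    exact fun i hi hn => hn (hall i hi)
  have h1 : ((∑ i ∈ T, r i % P₁ : ℕ) : ℤ) ≤ ((c : ℤ) - 1) * (P₁ : ℕ) := h
  rw [hsum0, hc0] at h1
  push_cast at h1
  have : (0 : ℤ) < (p : ℤ) ^ (ℓ + 1) := by positivity
  linarith

omit [Fintype σ] [DecidableEq σ] [DecidableEq K] hp [CharP K p] in
/-- Two distinct indices of `T` with multiplicities not divisible by `p^{ℓ+1}`, from the residue
inequality. [cite: HauserPerlega2019PRIMS, §3 Comment (d)] -/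
theorem exists_pair_of_residueInequality (ℓ : ℕ) (hp0 : 0 < p) (T : Finset σ) (r : σ → ℕ)
    (h : HauserPerlega2019.ResidueInequality p ℓ T r) :
    ∃ i₁ ∈ T, ∃ i₂ ∈ T, i₁ ≠ i₂ ∧ ¬ p ^ (ℓ + 1) ∣ r i₁ ∧ ¬ p ^ (ℓ + 1) ∣ r i₂ := by
  classical
  have h2 := two_le_card_of_residueInequality p ℓ hp0 T r h
  obtain ⟨i₁, hi₁, i₂, hi₂, hne⟩ :=
    (Finset.one_lt_card (s := T.filter fun i => ¬ p ^ (ℓ + 1) ∣ r i)).mp (by omega)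
  rw [Finset.mem_filter] at hi₁ hi₂
  exact ⟨i₁, hi₁.1, i₂, hi₂.1, hne, hi₁.2, hi₂.2⟩

/-- **[HP19 PRIMS] Comment (d) / [HP24] p. 777: an increase of the shade loses (at least) two
exceptional components, both with multiplicity not divisible by `q = pᵉ`** — every `e ≥ 1`, every
dimension, every field of characteristic `p`, every point of every chart. Precisely: if `s = (F, r)`
is cleaned with `ord₀ F = o ≥ q`, `y^r ∣ F`, and the shade increases at the point `b` of the
`y_j`-chart, then there are two distinct indices `i₁ ≠ i₂`, each equal to `j` or translated
(`b_i ≠ 0`) — i.e. the components `{y_{i₁} = 0}`, `{y_{i₂} = 0}` are LOST at `b` — with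
`q ∤ r_{i₁}`, `q ∤ r_{i₂}` (in particular `r_{i₁}, r_{i₂} ≠ 0`: both are exceptional components
through the old point). "The increase `d′_res > d_res` can only happen if `E_a` has two components
and both are lost under the localized point blowup" ([HP24] p. 777, surfaces); "(d) The increase
of the residual order can only happen if under the blowup at least two components of `D` are lost"
([HP19 PRIMS] §3). The tree's earlier necessary condition `necessary_of_shadeIncreases_pow` (iii)
gives ONE lost component with a non-`q`-divisible initial EXPONENT; this one gives TWO with
non-`q`-divisible MULTIPLICITIES. [cite: HauserPerlega2019PRIMS, §3 Comment (d)]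
[cite: HauserPerlega2024, §4 (p. 777)] -/
theorem exists_two_lost_of_shadeIncreases {e : ℕ} (he : 1 ≤ e) (j : σ) (b : σ → K)
    (hbj : b j = 0) (s : State σ K) (hclean : deletePthPowers (p ^ e) s.F = s.F) {o : ℕ}
    (ho : ordZero s.F = o) (hqo : p ^ e ≤ o) (hr : ∀ d ∈ s.F.support, s.r ≤ d)
    (hinc : ShadeIncreases (p ^ e) j b s) :
    ∃ i₁ i₂ : σ, i₁ ≠ i₂ ∧ (i₁ = j ∨ b i₁ ≠ 0) ∧ (i₂ = j ∨ b i₂ ≠ 0) ∧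
      ¬ p ^ e ∣ s.r i₁ ∧ ¬ p ^ e ∣ s.r i₂ := by
  classical
  have h := residueInequality_of_shadeIncreases_of_clean p he j b hbj s hclean ho hqo hr hinc
  obtain ⟨k, rfl⟩ : ∃ k, e = k + 1 := ⟨e - 1, by omega⟩
  rw [Nat.add_sub_cancel] at h
  obtain ⟨i₁, hi₁, i₂, hi₂, hne, h₁, h₂⟩ := exists_pair_of_residueInequality p k hp.out.pos _ _ h
  simp only [lostComponents, Finset.mem_filter, Finset.mem_univ, true_and] at hi₁ hi₂
  exact ⟨i₁, i₂, hne, hi₁, hi₂, h₁, h₂⟩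

/-- **Corollary: an increase needs two exceptional components with multiplicities not divisible
by `q` through the old point** (the state-level form of "the increase can only happen if `E_a` has
two components", [HP24] p. 777): if at most one index `i` has `q ∤ r_i`, the shade does not
increase at ANY point of ANY chart. [cite: HauserPerlega2024, §4 (p. 777)] -/
theorem not_shadeIncreases_of_card_le_one {e : ℕ} (he : 1 ≤ e) (j : σ) (b : σ → K)
    (hbj : b j = 0) (s : State σ K) (hclean : deletePthPowers (p ^ e) s.F = s.F) {o : ℕ}
    (ho : ordZero s.F = o) (hqo : p ^ e ≤ o) (hr : ∀ d ∈ s.F.support, s.r ≤ d)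
    (hcard : (Finset.univ.filter fun i => ¬ p ^ e ∣ s.r i).card ≤ 1) :
    ¬ ShadeIncreases (p ^ e) j b s := by
  classical
  intro hinc
  obtain ⟨i₁, i₂, hne, -, -, h₁, h₂⟩ :=
    exists_two_lost_of_shadeIncreases p he j b hbj s hclean ho hqo hr hinc
  have h2 : 1 < (Finset.univ.filter fun i => ¬ p ^ e ∣ s.r i).card := by
    rw [Finset.one_lt_card]
    exact ⟨i₁, by simp [h₁], i₂, by simp [h₂], hne⟩
  omega

end Main

/-! ## 5. Counting the exceptional components with multiplicity `≢ 0 (mod q)` along a sequence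
(consequences of Comment (d) in the model; derived here, not printed in this form) -/

section Counting

variable {σ : Type*} {K : Type*} [Field K] [Fintype σ] [DecidableEq σ] [DecidableEq K]
variable (p : ℕ) [hp : Fact p.Prime] [CharP K p]

omit hp [CharP K p] in
/-- **The multiplicities `≢ 0 (mod q)` after one point blow-up**: they sit at the KEPT old
components (`i ≠ j`, `b_i = 0`) with `q ∤ r_i`, and at the new component `{y_j = 0}` iff
`q ∤ o − q` (its multiplicity is `r′_j = o − q`). [folklore] -/
theorem filter_not_dvd_step_r_eq (q : ℕ) (j : σ) (b : σ → K) (hbj : b j = 0) (s : State σ K)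
    {o : ℕ} (ho : ordZero s.F = o) :
    (Finset.univ.filter fun i => ¬ q ∣ (step q j b s).r i) =
      (Finset.univ.filter fun i => i ≠ j ∧ b i = 0 ∧ ¬ q ∣ s.r i) ∪
        (Finset.univ.filter fun i => i = j ∧ ¬ q ∣ o - q) := by
  ext i
  simp only [Finset.mem_filter, Finset.mem_union, Finset.mem_univ, true_and]
  show ¬ q ∣ newMult q j b s i ↔ _
  rw [newMult_eq q j b hbj s ho, Finsupp.filter_apply, Finsupp.update_apply]
  by_cases hij : i = j
  · subst hij
    simp [hbj]
  · by_cases hbi : b i = 0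
    · simp [hij, hbi]
    · simp [hij, hbi]

omit hp [CharP K p] in
/-- Kept and lost indices with multiplicity `≢ 0 (mod q)` partition all such indices. [folklore] -/
theorem card_kept_add_card_lost_eq (q : ℕ) (j : σ) (b : σ → K) (r : σ →₀ ℕ) :
    (Finset.univ.filter fun i => i ≠ j ∧ b i = 0 ∧ ¬ q ∣ r i).card +
      (Finset.univ.filter fun i => (i = j ∨ b i ≠ 0) ∧ ¬ q ∣ r i).card =
      (Finset.univ.filter fun i => ¬ q ∣ r i).card := by
  rw [← Finset.card_union_of_disjoint]
  · congr 1
    ext i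
    simp only [Finset.mem_union, Finset.mem_filter, Finset.mem_univ, true_and]
    by_cases hij : i = j <;> by_cases hbi : b i = 0 <;> simp [hij, hbi]
  · rw [Finset.disjoint_filter]
    intro i _ h1 h2
    rcases h2.1 with h | h
    · exact h1.1 h
    · exact h h1.2.1

omit hp [CharP K p] in
/-- **One blow-up creates at most one multiplicity `≢ 0 (mod q)`** (none if `q ∣ o − q`), and
keeps only the kept ones. [folklore] -/
theorem card_filter_not_dvd_step_r_le (q : ℕ) (j : σ) (b : σ → K) (hbj : b j = 0)
    (s : State σ K) {o : ℕ} (ho : ordZero s.F = o) :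
    (Finset.univ.filter fun i => ¬ q ∣ (step q j b s).r i).card ≤
      (Finset.univ.filter fun i => i ≠ j ∧ b i = 0 ∧ ¬ q ∣ s.r i).card +
        (if q ∣ o - q then 0 else 1) := by
  rw [filter_not_dvd_step_r_eq q j b hbj s ho]
  refine (Finset.card_union_le _ _).trans (add_le_add le_rfl ?_)
  split_ifs with h
  · rw [Nat.le_zero, Finset.card_eq_zero, Finset.filter_eq_empty_iff]
    exact fun i _ hi => hi.2 h
  · refine (Finset.card_le_one.mpr ?_)
    intro x hx y hy
    rw [Finset.mem_filter] at hx hy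
    rw [hx.2.1, hy.2.1]

/-- **An increase consumes two multiplicities `≢ 0 (mod q)` and creates none** (`q = pᵉ`,
`e ≥ 1`, cleaned state, every dimension): after a shade increase at `(j, b)` the number of indices
`i` with `q ∤ r′_i` is at most the number before MINUS TWO — the two lost components of Comment (d)
are gone, and the new component has multiplicity `o − q ≡ 0 (mod q)` by assertion (2)
(`q ∣ o`, Probe 1). Consequence of `exists_two_lost_of_shadeIncreases`; derived in the model.
[cite: HauserPerlega2019PRIMS, §3 Comment (d)] -/
theorem card_filter_not_dvd_step_r_add_two_le_of_shadeIncreases {e : ℕ} (he : 1 ≤ e) (j : σ)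
    (b : σ → K) (hbj : b j = 0) (s : State σ K) (hclean : deletePthPowers (p ^ e) s.F = s.F)
    {o : ℕ} (ho : ordZero s.F = o) (hqo : p ^ e ≤ o) (hr : ∀ d ∈ s.F.support, s.r ≤ d)
    (hinc : ShadeIncreases (p ^ e) j b s) :
    (Finset.univ.filter fun i => ¬ p ^ e ∣ (step (p ^ e) j b s).r i).card + 2 ≤
      (Finset.univ.filter fun i => ¬ p ^ e ∣ s.r i).card := by
  classical
  have hqo' : p ^ e ∣ o := by
    by_contra hndvd
    exact absurd hinc (not_lt.mpr (shade_step_le_of_not_dvd (p ^ e) j b hbj s ho hqo hr hndvd))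
  have hdvd : p ^ e ∣ o - p ^ e := Nat.dvd_sub hqo' dvd_rfl
  have h1 := card_filter_not_dvd_step_r_le (p ^ e) j b hbj s ho
  rw [if_pos hdvd, add_zero] at h1
  obtain ⟨i₁, i₂, hne, hi₁, hi₂, h₁, h₂⟩ :=
    exists_two_lost_of_shadeIncreases p he j b hbj s hclean ho hqo hr hinc
  have h2 : 2 ≤ (Finset.univ.filter fun i => (i = j ∨ b i ≠ 0) ∧ ¬ p ^ e ∣ s.r i).card := by
    have : 1 < (Finset.univ.filter fun i => (i = j ∨ b i ≠ 0) ∧ ¬ p ^ e ∣ s.r i).card := by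
      rw [Finset.one_lt_card]
      exact ⟨i₁, by simp [hi₁, h₁], i₂, by simp [hi₂, h₂], hne⟩
    omega
  have h3 := card_kept_add_card_lost_eq (p ^ e) j b s.r
  omega

/-- **Coin counting along a sequence of point blow-ups** (every `e ≥ 1`, every dimension): along
`s (n+1) = step q (j n) (b n) (s n)` (`q = pᵉ`, points on the new exceptional divisors, cleaned
start with `y^r ∣ F ≠ 0`, order `≥ q` throughout), let `c_n` be the number of indices `i` with
`q ∤ r_i` at stage `n`, `J_N` the number of shade increases among the first `N` steps, and `M_N`
the number of non-increasing steps among them taken at a state whose order is NOT divisible by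
`q`. Then `2·J_N + c_N ≤ c_0 + M_N`: every increase spends two multiplicities `≢ 0 (mod q)`
(Comment (d)) and mints none; every other step mints at most one, and only when `q ∤ ord₀ F_n`.
In particular increases are at most half as frequent as the steps at orders `≢ 0 (mod q)`, up to
the initial stock `c_0 ≤ n`. Derived in the model from `exists_two_lost_of_shadeIncreases`.
[cite: HauserPerlega2019PRIMS, §3 Comment (d)] -/
theorem two_mul_card_increases_add_card_le {e : ℕ} (he : 1 ≤ e) (s : ℕ → State σ K)
    (j : ℕ → σ) (b : ℕ → σ → K) (hb : ∀ n, b n (j n) = 0)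
    (hstep : ∀ n, s (n + 1) = step (p ^ e) (j n) (b n) (s n)) (hF0 : (s 0).F ≠ 0)
    (hclean : deletePthPowers (p ^ e) (s 0).F = (s 0).F)
    (hr : ∀ d ∈ (s 0).F.support, (s 0).r ≤ d)
    (hord : ∀ n, ((p ^ e : ℕ) : ℕ∞) ≤ ordZero (s n).F) (N : ℕ) :
    2 * ((Finset.range N).filter fun n => (s n).shade < (s (n + 1)).shade).card +
        (Finset.univ.filter fun i => ¬ p ^ e ∣ (s N).r i).card ≤
      (Finset.univ.filter fun i => ¬ p ^ e ∣ (s 0).r i).card +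
        ((Finset.range N).filter fun n => ¬ (s n).shade < (s (n + 1)).shade ∧
          ¬ p ^ e ∣ (ordZero (s n).F).toNat).card := by
  classical
  -- invariants along the sequence: non-zero, cleaned, divisible by the exceptional monomial
  have hinv : ∀ n, (s n).F ≠ 0 ∧ deletePthPowers (p ^ e) (s n).F = (s n).F ∧
      ∀ d ∈ (s n).F.support, (s n).r ≤ d := by
    intro n
    induction n with
    | zero => exact ⟨hF0, hclean, hr⟩
    | succ n ih =>
      obtain ⟨ih0, ih1, ih2⟩ := ih
      have hne : ordZero (s n).F ≠ ⊤ := by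
        unfold ordZero
        rw [Ne, MvPowerSeries.order_eq_top_iff, MvPolynomial.coe_eq_zero_iff]
        exact ih0
      obtain ⟨o, ho'⟩ := WithTop.ne_top_iff_exists.mp hne
      have ho : ordZero (s n).F = o := ho'.symm
      have hqo : p ^ e ≤ o := by
        have := hord n
        rw [ho] at this
        exact_mod_cast this
      rw [hstep n]
      exact ⟨step_F_ne_zero_pow p (j n) (b n) (hb n) (s n) ih1 ho hqo ih2,
        deletePthPowers_step (p ^ e) (j n) (b n) (s n),
        newMult_le_of_mem_support_step (p ^ e) (j n) (b n) (hb n) (s n) ho ih2⟩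
  induction N with
  | zero => simp
  | succ N ih =>
    obtain ⟨h0, h1, h2⟩ := hinv N
    have hne : ordZero (s N).F ≠ ⊤ := by
      unfold ordZero
      rw [Ne, MvPowerSeries.order_eq_top_iff, MvPolynomial.coe_eq_zero_iff]
      exact h0
    obtain ⟨o, ho'⟩ := WithTop.ne_top_iff_exists.mp hne
    have ho : ordZero (s N).F = o := ho'.symm
    have hqo : p ^ e ≤ o := by
      have := hord N
      rw [ho] at this
      exact_mod_cast this
    have htoNat : (ordZero (s N).F).toNat = o := by rw [ho]; rfl
    rw [Finset.range_add_one, Finset.filter_insert, Finset.filter_insert]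
    by_cases hinc : (s N).shade < (s (N + 1)).shade
    · -- an increase: two coins spent, none minted
      have hinc' : ShadeIncreases (p ^ e) (j N) (b N) (s N) := by
        unfold ShadeIncreases; rw [← hstep N]; exact hinc
      have hc := card_filter_not_dvd_step_r_add_two_le_of_shadeIncreases p he (j N) (b N) (hb N)
        (s N) h1 ho hqo h2 hinc'
      rw [← hstep N] at hc
      rw [if_pos hinc, if_neg (fun h => h.1 hinc),
        Finset.card_insert_of_notMem (fun h => Finset.notMem_range_self (Finset.mem_filter.mp h).1)]
      omega
    · -- no increase: at most one coin minted, and only if `q ∤ o`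
      have hc := card_filter_not_dvd_step_r_le (p ^ e) (j N) (b N) (hb N) (s N) ho
      rw [← hstep N] at hc
      have hkept : (Finset.univ.filter fun i => i ≠ j N ∧ b N i = 0 ∧ ¬ p ^ e ∣ (s N).r i).card ≤
          (Finset.univ.filter fun i => ¬ p ^ e ∣ (s N).r i).card := by
        refine Finset.card_le_card fun i hi => ?_
        rw [Finset.mem_filter] at hi ⊢
        exact ⟨hi.1, hi.2.2.2⟩
      rw [if_neg hinc]
      by_cases hdvd : p ^ e ∣ o
      · have hdvd' : p ^ e ∣ o - p ^ e := Nat.dvd_sub hdvd dvd_rfl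
        rw [if_pos hdvd', add_zero] at hc
        rw [if_neg (fun h => h.2 (htoNat ▸ hdvd))]
        omega
      · have hndvd' : ¬ p ^ e ∣ o - p ^ e := fun h => hdvd (by
          have := Nat.dvd_add h (dvd_refl (p ^ e))
          rwa [Nat.sub_add_cancel hqo] at this)
        rw [if_neg hndvd'] at hc
        rw [if_pos ⟨hinc, htoNat ▸ hdvd⟩,
          Finset.card_insert_of_notMem (fun h => Finset.notMem_range_self (Finset.mem_filter.mp h).1)]
        omega

/-- **After an increase that leaves no multiplicity `≢ 0 (mod q)`, the next two blow-ups do not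
increase the shade** (every `e ≥ 1`, every dimension; e.g. whenever all such components were lost
at the increase — always the case for SURFACES, `two_steps_after_increase_of_card_eq_two`).
Derived in the model: the next state has `c = 0`, the one after it `c ≤ 1`, and an increase needs
`c ≥ 2` (`not_shadeIncreases_of_card_le_one`). [cite: HauserPerlega2024, §4 (pp. 777–778)] -/
theorem not_shadeIncreases_two_steps_of_card_eq_zero {e : ℕ} (he : 1 ≤ e) (s : ℕ → State σ K)
    (j : ℕ → σ) (b : ℕ → σ → K) (hb : ∀ n, b n (j n) = 0)
    (hstep : ∀ n, s (n + 1) = step (p ^ e) (j n) (b n) (s n)) (hF0 : (s 0).F ≠ 0)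
    (hclean : deletePthPowers (p ^ e) (s 0).F = (s 0).F)
    (hr : ∀ d ∈ (s 0).F.support, (s 0).r ≤ d)
    (hord : ∀ n, ((p ^ e : ℕ) : ℕ∞) ≤ ordZero (s n).F) (n : ℕ)
    (hc : (Finset.univ.filter fun i => ¬ p ^ e ∣ (s (n + 1)).r i).card = 0) :
    ¬ (s (n + 1)).shade < (s (n + 2)).shade ∧ ¬ (s (n + 2)).shade < (s (n + 3)).shade := by
  classical
  have hinv : ∀ n, (s n).F ≠ 0 ∧ deletePthPowers (p ^ e) (s n).F = (s n).F ∧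
      ∀ d ∈ (s n).F.support, (s n).r ≤ d := by
    intro n
    induction n with
    | zero => exact ⟨hF0, hclean, hr⟩
    | succ n ih =>
      obtain ⟨ih0, ih1, ih2⟩ := ih
      have hne : ordZero (s n).F ≠ ⊤ := by
        unfold ordZero
        rw [Ne, MvPowerSeries.order_eq_top_iff, MvPolynomial.coe_eq_zero_iff]
        exact ih0
      obtain ⟨o, ho'⟩ := WithTop.ne_top_iff_exists.mp hne
      have ho : ordZero (s n).F = o := ho'.symm
      have hqo : p ^ e ≤ o := by
        have := hord n
        rw [ho] at this
        exact_mod_cast this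
      rw [hstep n]
      exact ⟨step_F_ne_zero_pow p (j n) (b n) (hb n) (s n) ih1 ho hqo ih2,
        deletePthPowers_step (p ^ e) (j n) (b n) (s n),
        newMult_le_of_mem_support_step (p ^ e) (j n) (b n) (hb n) (s n) ho ih2⟩
  -- natural orders at stages `n+1`, `n+2`
  have hnat : ∀ m, ∃ o : ℕ, ordZero (s m).F = o ∧ p ^ e ≤ o := by
    intro m
    have hne : ordZero (s m).F ≠ ⊤ := by
      unfold ordZero
      rw [Ne, MvPowerSeries.order_eq_top_iff, MvPolynomial.coe_eq_zero_iff]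
      exact (hinv m).1
    obtain ⟨o, ho'⟩ := WithTop.ne_top_iff_exists.mp hne
    have ho : ordZero (s m).F = o := ho'.symm
    refine ⟨o, ho, ?_⟩
    have := hord m
    rw [ho] at this
    exact_mod_cast this
  obtain ⟨o₁, ho₁, hqo₁⟩ := hnat (n + 1)
  obtain ⟨o₂, ho₂, hqo₂⟩ := hnat (n + 2)
  have hs2 : s (n + 2) = step (p ^ e) (j (n + 1)) (b (n + 1)) (s (n + 1)) := hstep (n + 1)
  have hs3 : s (n + 3) = step (p ^ e) (j (n + 2)) (b (n + 2)) (s (n + 2)) := hstep (n + 2)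
  -- stage `n+2` has at most one multiplicity `≢ 0 (mod q)`
  have hc2 : (Finset.univ.filter fun i => ¬ p ^ e ∣ (s (n + 2)).r i).card ≤ 1 := by
    have h := card_filter_not_dvd_step_r_le (p ^ e) (j (n + 1)) (b (n + 1)) (hb (n + 1))
      (s (n + 1)) ho₁
    rw [← hs2] at h
    have hkept : (Finset.univ.filter fun i =>
        i ≠ j (n + 1) ∧ b (n + 1) i = 0 ∧ ¬ p ^ e ∣ (s (n + 1)).r i).card = 0 := by
      rw [← Nat.le_zero, ← hc]
      refine Finset.card_le_card fun i hi => ?_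
      rw [Finset.mem_filter] at hi ⊢
      exact ⟨hi.1, hi.2.2.2⟩
    have : (if p ^ e ∣ o₁ - p ^ e then 0 else 1) ≤ 1 := by split_ifs <;> omega
    omega
  refine ⟨?_, ?_⟩
  · have := not_shadeIncreases_of_card_le_one p he (j (n + 1)) (b (n + 1)) (hb (n + 1))
      (s (n + 1)) (hinv (n + 1)).2.1 ho₁ hqo₁ (hinv (n + 1)).2.2 (by rw [hc]; exact Nat.zero_le _)
    unfold ShadeIncreases at this
    rwa [← hs2] at this
  · have := not_shadeIncreases_of_card_le_one p he (j (n + 2)) (b (n + 2)) (hb (n + 2))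
      (s (n + 2)) (hinv (n + 2)).2.1 ho₂ hqo₂ (hinv (n + 2)).2.2 hc2
    unfold ShadeIncreases at this
    rwa [← hs3] at this

/-- **Surfaces (`n = 2` residual variables): after an increase of the shade, neither of the next
two point blow-ups increases it** — `q = pᵉ`, every `e ≥ 1`, every field of characteristic `p`,
every choice of points. An increase loses BOTH exceptional components (Comment (d) with two
variables), so the next state has the single exceptional component `{y_j = 0}` with multiplicity
`o − q ≡ 0 (mod q)`. ("In the case `e = 1` … the increase is at most 1 and can be remedied without
too much effort" and the "packages of blowups" of [HP24] §4, pp. 777–778, concern exactly these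
configurations; the two-step statement is derived here in the model, for every `e`.)
[cite: HauserPerlega2024, §4 (pp. 777–778)] -/
theorem not_shadeIncreases_two_steps_after_increase_of_card_eq_two (hσ : Fintype.card σ = 2)
    {e : ℕ} (he : 1 ≤ e) (s : ℕ → State σ K) (j : ℕ → σ) (b : ℕ → σ → K)
    (hb : ∀ n, b n (j n) = 0) (hstep : ∀ n, s (n + 1) = step (p ^ e) (j n) (b n) (s n))
    (hF0 : (s 0).F ≠ 0) (hclean : deletePthPowers (p ^ e) (s 0).F = (s 0).F)
    (hr : ∀ d ∈ (s 0).F.support, (s 0).r ≤ d)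
    (hord : ∀ n, ((p ^ e : ℕ) : ℕ∞) ≤ ordZero (s n).F) (n : ℕ)
    (hinc : (s n).shade < (s (n + 1)).shade) :
    ¬ (s (n + 1)).shade < (s (n + 2)).shade ∧ ¬ (s (n + 2)).shade < (s (n + 3)).shade := by
  classical
  refine not_shadeIncreases_two_steps_of_card_eq_zero p he s j b hb hstep hF0 hclean hr hord n ?_
  -- the coin count, one-step form: `c_{n+1} + 2 ≤ c_n ≤ card σ = 2`
  have hinv : ∀ n, (s n).F ≠ 0 ∧ deletePthPowers (p ^ e) (s n).F = (s n).F ∧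
      ∀ d ∈ (s n).F.support, (s n).r ≤ d := by
    intro n
    induction n with
    | zero => exact ⟨hF0, hclean, hr⟩
    | succ n ih =>
      obtain ⟨ih0, ih1, ih2⟩ := ih
      have hne : ordZero (s n).F ≠ ⊤ := by
        unfold ordZero
        rw [Ne, MvPowerSeries.order_eq_top_iff, MvPolynomial.coe_eq_zero_iff]
        exact ih0
      obtain ⟨o, ho'⟩ := WithTop.ne_top_iff_exists.mp hne
      have ho : ordZero (s n).F = o := ho'.symm
      have hqo : p ^ e ≤ o := by
        have := hord n
        rw [ho] at this
        exact_mod_cast this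
      rw [hstep n]
      exact ⟨step_F_ne_zero_pow p (j n) (b n) (hb n) (s n) ih1 ho hqo ih2,
        deletePthPowers_step (p ^ e) (j n) (b n) (s n),
        newMult_le_of_mem_support_step (p ^ e) (j n) (b n) (hb n) (s n) ho ih2⟩
  obtain ⟨h0, h1, h2⟩ := hinv n
  have hne : ordZero (s n).F ≠ ⊤ := by
    unfold ordZero
    rw [Ne, MvPowerSeries.order_eq_top_iff, MvPolynomial.coe_eq_zero_iff]
    exact h0
  obtain ⟨o, ho'⟩ := WithTop.ne_top_iff_exists.mp hne
  have ho : ordZero (s n).F = o := ho'.symm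
  have hqo : p ^ e ≤ o := by
    have := hord n
    rw [ho] at this
    exact_mod_cast this
  have hinc' : ShadeIncreases (p ^ e) (j n) (b n) (s n) := by
    unfold ShadeIncreases; rw [← hstep n]; exact hinc
  have hc := card_filter_not_dvd_step_r_add_two_le_of_shadeIncreases p he (j n) (b n) (hb n)
    (s n) h1 ho hqo h2 hinc'
  rw [← hstep n] at hc
  have hle : (Finset.univ.filter fun i => ¬ p ^ e ∣ (s n).r i).card ≤ 2 :=
    hσ ▸ Finset.card_le_univ _
  omega

end Counting

end PointBlowup

end Literature.AlgebraicGeometry.Resolution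

end
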